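import Literature.NumberTheory.LFunctions.MoebiusWalshTypeIIHigh
import Literature.NumberTheory.LFunctions.MoebiusWalshCounting
import Literature.NumberTheory.Sieve.VaughanMeanValueDecomposition
import Mathlib.Analysis.MeanInequalitiesPow
import HarnessLib

/-!
# Type-II pair count for shifted windows, II: the Walsh data plugged in, the `w ↦ W` substitution, and the evaluated bound (Bourgain 2013, §2 (2.3)–(2.4), (2.23)–(2.28)) — proved

Topic `Literature/NumberTheory/LFunctions`; continuation of `MoebiusWalshTypeIIHigh.lean` (the
abstract pair count `pairSum` for the shifted digit windows `K ≥ μ − ρ` of J. Bourgain,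
*Möbius–Walsh correlation bounds and an estimate of Mauduit and Rivat*, J. Anal. Math. **119** (2013)
147–163 = arXiv:1109.2784 [Bourgain2013MoebiusWalsh], §2). Everything here is PROVED (theorems, and
three elementary `def`s with bodies: `blockBound`, `windowBoundL6`, `windowBoundSup`, naming the
right-hand side of `pairSum_block_le` and the two window majorants); no named fact.

## Contents (namespace `Literature.NumberTheory.LFunctions.MoebiusWalsh`)

* **The substitution `w_{S'} ↦ W_{S'}` ((2.3)–(2.4))** — `sum_abs_sum_natWalsh_mul_le_localised_add`:
  for the truncated digit set `T ⊆ [K, K+σ)` and its localised substitute `W` (Lemma 5, `K₁ ≥ 2`,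
  `4K₁ ≤ 2^K`), a set `S_a` of positive integers (the smooth variable) and a range `[B₀, B₀+N_b)`
  of the long variable with all products `a(b+δ) ≤ X`,
  `∑_b |∑_a w_T(a(b+δ)) w_T(ab)| ≤ ∑_b |∑_a W(a(b+δ)) W(ab)| + 4 √(X(1+log X)³) √(((X+1)/2^{K+σ} + 2) 2^{K+σ}/(2(K₁−1)))`;
  Bourgain: "`(2.4) < X(∑_{x<X}|w_{S'}(x) − W_{S'}(x)|²)^{1/2}(∑_{x∈X} d(x)²)^{1/2} < L^{-cε}X²`" —
  here with the tree's `∑_{x≤X} τ(x)² ≤ X(1+log X)³` (`Sieve.Vaughan.sum_sq_card_divisors_le`) and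
  Lemma 5 (1.12) (`sum_norm_sq_localisedWalsh_sub_walshNat_le`), through the divisor-weighted form
  of a box sum (`sum_sum_mul_le_sum_divisors`, `sum_divisors_mul_le_sqrt`).
* **The structural bound with the Fourier data of Lemmas 2, 5, 6** — `pairSum_localised_le`:
  `pairSum |Ŵ| … ≤ diagonal (η = 2·2^{-c₂|S'|}) + long arcs (A₁ = 4(K+2)2^{κσ}) + ∑_e min(blockBound … J₆, blockBound … J_∞)`
  with `J₆(Λ) = 4 min(Λ, 2^{K+σ})^κ` (Lemma 6; beyond one period the support of `Ŵ` is used) and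
  `J_∞(Λ) = ηΛ` (Lemma 2).
* **The evaluated bound ((2.25)–(2.28))** — `blockBound_sup_le` ((2.27): blocks with
  `2^e(N₀+N)/2^K < y`), `blockBound_L6_le` ((2.25)–(2.26): blocks with `2^e(N₀+N)/2^K ≥ y`, saving
  `y^{κ−1/2}`, `1/2 − κ = 0.057…`), and their sum `pairSum_localised_le_explicit`:
  `pairSum ≤ MN·{η²(4K₁+2)(2L + L'(1+log 2^σ)) + A₁²(130(I+2)/M + 8K₁/2^K + 4/N)`
  `+ E·(2η²C_R[(I+2)(5(I+2)L' + 5y/N)(2L'+4y+1) + 2(I+1)L'y] + 32C_R[83(I+2)²L'²y^{κ−1/2} + 25(I+2)(L'M)^{2κ}/N + 19(I+2)L'(L'M)^κ/√N])}`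
  (`I = log₂M`, `E = σ + log₂K₁ + 3`, `C_R = 4K₁L + 2`, `2^σ ≤ L'M`, `M ≤ N`, `N₀ ≤ N`, `2^K ≤ N`,
  `y ≥ 1`, `L' ≥ 1`). In the paper's ranges (`M = 2^μ > C^H`, `L = 2^H`, `L' ≍ L^{1+ε}`, `K₁ = L^ε`,
  `y = L^C`, `|S'| > CH`, `N ≥ M`) every term is `≪ L^{-c}` up to powers of `log X`, which is (2.28)
  for the shifted windows; the choice of `y`, `K₁`, `K` is left to the type-II estimate.

The exponent bookkeeping of (2.25) is isolated in `rpow_block_key`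
(`D^s T^u Nt^v ≤ y^s Nt^{u+v}` for `yT/Nt ≤ D`, `T ≤ Nt`, `s ≤ 0 ≤ s+u`).

## References

* J. Bourgain, J. Anal. Math. 119 (2013) 147–163; arXiv:1109.2784, §2 (2.3)–(2.4), (2.9)–(2.10),
  (2.23)–(2.28); §1 Lemma 5 (1.11)–(1.13), Lemma 6. [Bourgain2013MoebiusWalsh]
* C. Mauduit, J. Rivat, Ann. of Math. 171 (2010) 1591–1646, §5. 
-/

noncomputable section

open Finset Real

namespace Literature.NumberTheory.LFunctions.MoebiusWalsh

open Literature.NumberTheory.Sieve.Vinogradov (distInt geomBound distInt_nonneg geomBound_le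
  geomBound_nonneg)
open Literature.NumberTheory.LFunctions.MoebiusWalshVaughan (natWalsh abs_natWalsh)
open Literature.NumberTheory.Sieve.Vaughan (sum_sq_card_divisors_le)

/-! ### Products `ab` counted with the divisor function -/

/-- **Box sums are divisor-weighted sums**: for `g ≥ 0` and sets of positive integers with all
products `ab ≤ X`, `∑_{a ∈ S_a} ∑_{b ∈ S_b} g(ab) ≤ ∑_{0 < x ≤ X} τ(x) g(x)` (each `x` arises from
at most `τ(x)` pairs, `a ∣ x`). [cite: Bourgain2013MoebiusWalsh, (2.4) ("`(∑_{x ∈ X} d(x)²)^{1/2}`")] -/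
theorem sum_sum_mul_le_sum_divisors (Sa Sb : Finset ℕ) {g : ℕ → ℝ} (hg : ∀ x, 0 ≤ g x) {X : ℕ}
    (hpos : ∀ a ∈ Sa, ∀ b ∈ Sb, 0 < a * b) (hX : ∀ a ∈ Sa, ∀ b ∈ Sb, a * b ≤ X) :
    ∑ a ∈ Sa, ∑ b ∈ Sb, g (a * b) ≤ ∑ x ∈ Ioc 0 X, (x.divisors.card : ℝ) * g x := by
  classical
  set s := Sa ×ˢ Sb with hs
  set m : ℕ × ℕ → ℕ := fun p => p.1 * p.2 with hm
  have h1 : ∑ a ∈ Sa, ∑ b ∈ Sb, g (a * b) = ∑ p ∈ s, g (m p) := by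
    rw [hs, Finset.sum_product]
  rw [h1, Finset.sum_comp]
  have hfib : ∀ x ∈ s.image m, ((s.filter fun p => m p = x).card : ℝ) ≤ x.divisors.card := by
    intro x hx
    rw [Finset.mem_image] at hx
    obtain ⟨p, hp, rfl⟩ := hx
    rw [hs, Finset.mem_product] at hp
    have hx0 : m p ≠ 0 := (hpos p.1 hp.1 p.2 hp.2).ne'
    have hinj : Set.InjOn (fun p : ℕ × ℕ => p.1) (s.filter fun p' => m p' = m p : Set (ℕ × ℕ)) := by
      intro a ha b hb hab
      simp only [Finset.coe_filter, Set.mem_setOf_eq, hs, Finset.mem_product] at ha hb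
      have ha0 : 0 < a.1 := Nat.pos_of_ne_zero fun h => by
        have := ha.2; simp only [hm, h, zero_mul] at this; exact hx0 this.symm
      have hab' : a.1 = b.1 := hab
      apply Prod.ext hab'
      have h2 : a.1 * a.2 = a.1 * b.2 := by
        have e1 : m a = m b := by rw [ha.2, hb.2]
        simp only [hm] at e1; rw [e1, hab']
      exact Nat.eq_of_mul_eq_mul_left ha0 h2
    have hmaps : ∀ p' ∈ s.filter (fun p' => m p' = m p), (fun p : ℕ × ℕ => p.1) p' ∈ (m p).divisors := by
      intro p' hp'
      rw [Finset.mem_filter] at hp'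
      rw [Nat.mem_divisors]
      exact ⟨⟨p'.2, by rw [← hp'.2]⟩, hx0⟩
    exact_mod_cast Finset.card_le_card_of_injOn _ hmaps hinj
  calc ∑ x ∈ s.image m, (s.filter fun p => m p = x).card • g x
      ≤ ∑ x ∈ s.image m, (x.divisors.card : ℝ) * g x := by
        refine Finset.sum_le_sum fun x hx => ?_
        rw [nsmul_eq_mul]
        exact mul_le_mul_of_nonneg_right (hfib x hx) (hg x)
    _ ≤ ∑ x ∈ Ioc 0 X, (x.divisors.card : ℝ) * g x := by
        refine Finset.sum_le_sum_of_subset_of_nonneg ?_ fun x _ _ => mul_nonneg (Nat.cast_nonneg _) (hg x)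
        intro x hx
        rw [Finset.mem_image] at hx
        obtain ⟨p, hp, rfl⟩ := hx
        rw [hs, Finset.mem_product] at hp
        rw [Finset.mem_Ioc]
        exact ⟨hpos p.1 hp.1 p.2 hp.2, hX p.1 hp.1 p.2 hp.2⟩

/-- **Cauchy–Schwarz against `∑ τ²`** (Bourgain 2013, (2.4)): for `g ≥ 0`,
`∑_{0<x≤X} τ(x) g(x) ≤ √(X(1 + log X)³) · √(∑_{0<x≤X} g(x)²)` (tree: `∑_{x≤X} τ(x)² ≤ X(1+log X)³`).
[cite: Bourgain2013MoebiusWalsh, (2.4)] -/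
theorem sum_divisors_mul_le_sqrt (g : ℕ → ℝ) (X : ℕ) :
    ∑ x ∈ Ioc 0 X, (x.divisors.card : ℝ) * g x ≤
      Real.sqrt (X * (1 + Real.log X) ^ 3) * Real.sqrt (∑ x ∈ Ioc 0 X, g x ^ 2) := by
  have hcs := Finset.sum_mul_sq_le_sq_mul_sq (Ioc 0 X) (fun x => (x.divisors.card : ℝ)) g
  have h1 : ∑ x ∈ Ioc 0 X, ((x.divisors.card : ℕ) : ℝ) ^ 2 ≤ X * (1 + Real.log X) ^ 3 :=
    sum_sq_card_divisors_le X
  have h2 : 0 ≤ ∑ x ∈ Ioc 0 X, g x ^ 2 := Finset.sum_nonneg fun x _ => sq_nonneg _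
  have h3 : (∑ x ∈ Ioc 0 X, (x.divisors.card : ℝ) * g x) ^ 2 ≤
      (X * (1 + Real.log X) ^ 3) * ∑ x ∈ Ioc 0 X, g x ^ 2 :=
    hcs.trans (mul_le_mul_of_nonneg_right h1 h2)
  have h4 : 0 ≤ (X : ℝ) * (1 + Real.log X) ^ 3 :=
    le_trans (Finset.sum_nonneg fun x _ => sq_nonneg _) h1
  calc ∑ x ∈ Ioc 0 X, (x.divisors.card : ℝ) * g x
      ≤ |∑ x ∈ Ioc 0 X, (x.divisors.card : ℝ) * g x| := le_abs_self _
    _ = Real.sqrt ((∑ x ∈ Ioc 0 X, (x.divisors.card : ℝ) * g x) ^ 2) := (Real.sqrt_sq_eq_abs _).symm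
    _ ≤ Real.sqrt ((X * (1 + Real.log X) ^ 3) * ∑ x ∈ Ioc 0 X, g x ^ 2) := Real.sqrt_le_sqrt h3
    _ = Real.sqrt (X * (1 + Real.log X) ^ 3) * Real.sqrt (∑ x ∈ Ioc 0 X, g x ^ 2) := Real.sqrt_mul h4 _


/-! ### The substitution `w_{S'} ↦ W_{S'}` in the differenced correlation (Bourgain 2013, (2.3)–(2.4)) -/

/-- Periodic nonnegative `g` on `ℕ`: `∑_{0 < x ≤ X} g(x) ≤ ((X+1)/P + 2) ∑_{x<P} g(x)`. [folklore] -/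
theorem sum_Ioc_le_of_periodic {g : ℕ → ℝ} (hg : ∀ x, 0 ≤ g x) {P : ℕ} (hP : 0 < P)
    (hper : ∀ x, g (x + P) = g x) (X : ℕ) :
    ∑ x ∈ Ioc 0 X, g x ≤ (((X + 1 : ℕ) : ℝ) / P + 2) * ∑ x ∈ range P, g x := by
  have hperk : ∀ t k, g (P * t + k) = g k := by
    intro t k
    induction t with
    | zero => simp
    | succ t ih => rw [show P * (t + 1) + k = (P * t + k) + P by ring, hper, ih]
  have h := sum_Ico_le_of_period_bound hg hP (B := ∑ x ∈ range P, g x)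
    (fun t => le_of_eq (Finset.sum_congr rfl fun k _ => hperk t k)) 0 (X + 1)
  refine le_trans ?_ h
  refine Finset.sum_le_sum_of_subset_of_nonneg ?_ fun x _ _ => hg x
  intro x hx; rw [Finset.mem_Ioc] at hx; rw [Finset.mem_Ico]; omega

set_option maxHeartbeats 1000000 in
/-- **The error of the substitution `w_{S'} ↦ W_{S'}` over a box** (Bourgain 2013, (2.3)–(2.4):
"`(2.4) < X (∑_{x<X} |w_{S'}(x) − W_{S'}(x)|²)^{1/2} (∑_{x∈X} d(x)²)^{1/2} < L^{-cε}X²`"). Let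
`T ⊆ [K, K+σ)` (the truncated digit set `S'`), `A` its `Fin (K+σ)`-indexed copy, `W = W_A` the
localised substitute (`K₁ ≥ 2`, `4K₁ ≤ 2^K`), `S_a` a set of positive integers and `[B₀, B₀+N_b)`
(`B₀ ≥ 1`) a range with all products `a(b+δ) ≤ X`. Then
`∑_b |∑_a w_T(a(b+δ)) w_T(ab)| ≤ ∑_b |∑_a W(a(b+δ)) W(ab)| + 4 √(X(1+log X)³) √(((X+1)/2^{K+σ} + 2) 2^{K+σ}/(2(K₁−1)))`
(pointwise `|ww − WW| ≤ |w−W|(ab') + 3|w−W|(ab)` as `|w| = 1`, `|W| ≤ 3`; the box sums of `|w−W|`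
are divisor-weighted sums, Cauchy–Schwarz against `∑τ² ≤ X(1+log X)³`, and Lemma 5 (1.12):
`∑_{x<2^{K+σ}} |W−w|² ≤ 2^{K+σ}/(2(K₁−1))`). [cite: Bourgain2013MoebiusWalsh, (2.3)–(2.4)] -/
theorem sum_abs_sum_natWalsh_mul_le_localised_add {K σ K₁ : ℕ} (T : Finset ℕ)
    (hT : ∀ t ∈ T, t < K + σ) (hTK : ∀ t ∈ T, K ≤ t) (hK₁ : 2 ≤ K₁) (hKq : 4 * K₁ ≤ 2 ^ K)
    (Sa : Finset ℕ) (hSa : ∀ a ∈ Sa, 0 < a) {B₀ : ℕ} (hB₀ : 0 < B₀) (Nb δ : ℕ) {X : ℕ}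
    (hX : ∀ a ∈ Sa, ∀ b ∈ Ico B₀ (B₀ + Nb), a * (b + δ) ≤ X) :
    ∑ b ∈ Ico B₀ (B₀ + Nb), |∑ a ∈ Sa, natWalsh T (a * (b + δ)) * natWalsh T (a * b)| ≤
      ∑ b ∈ Ico B₀ (B₀ + Nb), |∑ a ∈ Sa, localisedWalshRe K σ K₁ (T.attachFin hT) (a * (b + δ)) *
          localisedWalshRe K σ K₁ (T.attachFin hT) (a * b)| +
      4 * Real.sqrt (X * (1 + Real.log X) ^ 3) *
        Real.sqrt ((((X + 1 : ℕ) : ℝ) / 2 ^ (K + σ) + 2) * (2 ^ (K + σ) / (2 * ((K₁ : ℝ) - 1)))) := by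
  set A := T.attachFin hT with hAdef
  set W := localisedWalshRe K σ K₁ A with hW
  set w : ℕ → ℝ := fun x => natWalsh T x with hw
  have hA : ∀ j ∈ A, K ≤ (j : ℕ) := by
    intro j hj; rw [hAdef, Finset.mem_attachFin] at hj; exact hTK _ hj
  have hK0 : 0 < K₁ := by omega
  have h2N : 2 * (K₁ * 2 ^ σ) ≤ 2 ^ (K + σ) := by
    rw [pow_add, ← mul_assoc]; exact Nat.mul_le_mul_right _ (by omega)
  -- `w = walshNat A`, `|w| = 1`, `|W| ≤ 3`
  have hwA : ∀ x, w x = walshNat A x := fun x => natWalsh_eq_walshNat T hT x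
  have hw1 : ∀ x, |w x| = 1 := fun x => abs_natWalsh T x
  have hW3 : ∀ x, |W x| ≤ 3 := by
    intro x
    have h := norm_localisedWalsh_le hK0 h2N A x
    rwa [← coe_localisedWalshRe, Complex.norm_real, Real.norm_eq_abs] at h
  -- the error function and its mean square
  set g : ℕ → ℝ := fun x => |w x - W x| with hg
  have hg0 : ∀ x, 0 ≤ g x := fun x => abs_nonneg _
  have hgper : ∀ x, g (x + 2 ^ (K + σ)) = g x := by
    intro x
    simp only [hg, hwA, hW]
    rw [walshNat_add_two_pow]
    have h := localisedWalsh_add_two_pow K σ K₁ A x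
    rw [← coe_localisedWalshRe, ← coe_localisedWalshRe] at h
    rw [show localisedWalshRe K σ K₁ A (x + 2 ^ (K + σ)) = localisedWalshRe K σ K₁ A x by
      exact_mod_cast h]
  have hgsq : ∑ x ∈ range (2 ^ (K + σ)), g x ^ 2 ≤ 2 ^ (K + σ) / (2 * ((K₁ : ℝ) - 1)) := by
    have h := sum_norm_sq_localisedWalsh_sub_walshNat_le A hA hK₁ hKq
    refine le_trans (le_of_eq (Finset.sum_congr rfl fun x _ => ?_)) h
    simp only [hg, hwA, hW]
    rw [← coe_localisedWalshRe, ← Complex.ofReal_sub, Complex.norm_real, Real.norm_eq_abs, abs_sub_comm]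
  have hgIoc : ∑ x ∈ Ioc 0 X, g x ^ 2 ≤
      (((X + 1 : ℕ) : ℝ) / 2 ^ (K + σ) + 2) * (2 ^ (K + σ) / (2 * ((K₁ : ℝ) - 1))) := by
    have h := sum_Ioc_le_of_periodic (g := fun x => g x ^ 2) (fun x => sq_nonneg _) (Nat.two_pow_pos (K + σ))
      (fun x => by simp only [hgper]) X
    push_cast at h ⊢
    refine h.trans (mul_le_mul_of_nonneg_left hgsq (by positivity))
  -- the divisor-weighted bound for a box sum of `g`
  have hbox : ∀ (Sb : Finset ℕ), (∀ b ∈ Sb, 0 < b) → (∀ a ∈ Sa, ∀ b ∈ Sb, a * b ≤ X) →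
      ∑ a ∈ Sa, ∑ b ∈ Sb, g (a * b) ≤ Real.sqrt (X * (1 + Real.log X) ^ 3) *
        Real.sqrt ((((X + 1 : ℕ) : ℝ) / 2 ^ (K + σ) + 2) * (2 ^ (K + σ) / (2 * ((K₁ : ℝ) - 1)))) := by
    intro Sb hSb hXb
    refine (sum_sum_mul_le_sum_divisors Sa Sb hg0 (fun a ha b hb => Nat.mul_pos (hSa a ha) (hSb b hb)) hXb).trans ?_
    refine (sum_divisors_mul_le_sqrt g X).trans ?_
    exact mul_le_mul_of_nonneg_left (Real.sqrt_le_sqrt hgIoc) (Real.sqrt_nonneg _)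
  -- pointwise: `|w w - W W| ≤ g(ab') + 3 g(ab)`
  have hpt : ∀ a b : ℕ, |w (a * (b + δ)) * w (a * b) - W (a * (b + δ)) * W (a * b)| ≤
      g (a * (b + δ)) + 3 * g (a * b) := by
    intro a b
    have e : w (a * (b + δ)) * w (a * b) - W (a * (b + δ)) * W (a * b) =
        (w (a * (b + δ)) - W (a * (b + δ))) * w (a * b) + W (a * (b + δ)) * (w (a * b) - W (a * b)) := by ring
    rw [e]
    refine (abs_add_le _ _).trans ?_
    rw [abs_mul, abs_mul, hw1, mul_one]
    simp only [hg]
    have := hW3 (a * (b + δ))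
    have h0 : 0 ≤ |w (a * b) - W (a * b)| := abs_nonneg _
    nlinarith
  -- per `b`: triangle inequality
  have hb : ∀ b, |∑ a ∈ Sa, w (a * (b + δ)) * w (a * b)| ≤
      |∑ a ∈ Sa, W (a * (b + δ)) * W (a * b)| + ∑ a ∈ Sa, (g (a * (b + δ)) + 3 * g (a * b)) := by
    intro b
    have e : ∑ a ∈ Sa, w (a * (b + δ)) * w (a * b) = ∑ a ∈ Sa, W (a * (b + δ)) * W (a * b) +
        ∑ a ∈ Sa, (w (a * (b + δ)) * w (a * b) - W (a * (b + δ)) * W (a * b)) := by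
      rw [← Finset.sum_add_distrib]; refine Finset.sum_congr rfl fun a _ => ?_; ring
    rw [e]
    refine (abs_add_le _ _).trans (add_le_add le_rfl ?_)
    exact (Finset.abs_sum_le_sum_abs _ _).trans (Finset.sum_le_sum fun a _ => hpt a b)
  -- sum over `b`
  have hSb1 : ∀ b ∈ Ico B₀ (B₀ + Nb), 0 < b := fun b hb => by
    rw [Finset.mem_Ico] at hb; omega
  have hSb2 : ∀ b ∈ Ico (B₀ + δ) (B₀ + δ + Nb), 0 < b := fun b hb => by
    rw [Finset.mem_Ico] at hb; omega
  have hX1 : ∀ a ∈ Sa, ∀ b ∈ Ico B₀ (B₀ + Nb), a * b ≤ X := by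
    intro a ha b hb
    exact le_trans (Nat.mul_le_mul_left a (Nat.le_add_right b δ)) (hX a ha b hb)
  have hX2 : ∀ a ∈ Sa, ∀ b ∈ Ico (B₀ + δ) (B₀ + δ + Nb), a * b ≤ X := by
    intro a ha b hb
    rw [Finset.mem_Ico] at hb
    have h := hX a ha (b - δ) (by rw [Finset.mem_Ico]; omega)
    rwa [show b - δ + δ = b by omega] at h
  calc ∑ b ∈ Ico B₀ (B₀ + Nb), |∑ a ∈ Sa, w (a * (b + δ)) * w (a * b)|
      ≤ ∑ b ∈ Ico B₀ (B₀ + Nb), (|∑ a ∈ Sa, W (a * (b + δ)) * W (a * b)| +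
          ∑ a ∈ Sa, (g (a * (b + δ)) + 3 * g (a * b))) := Finset.sum_le_sum fun b _ => hb b
    _ = ∑ b ∈ Ico B₀ (B₀ + Nb), |∑ a ∈ Sa, W (a * (b + δ)) * W (a * b)| +
          (∑ a ∈ Sa, ∑ b ∈ Ico (B₀ + δ) (B₀ + δ + Nb), g (a * b) +
            3 * ∑ a ∈ Sa, ∑ b ∈ Ico B₀ (B₀ + Nb), g (a * b)) := by
        rw [Finset.sum_add_distrib]
        congr 1
        rw [Finset.sum_comm, Finset.mul_sum, ← Finset.sum_add_distrib]
        refine Finset.sum_congr rfl fun a _ => ?_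
        rw [Finset.sum_add_distrib, Finset.mul_sum]
        congr 1
        rw [show B₀ + δ + Nb = (B₀ + Nb) + δ by ring, ← Finset.sum_Ico_add']
    _ ≤ ∑ b ∈ Ico B₀ (B₀ + Nb), |∑ a ∈ Sa, W (a * (b + δ)) * W (a * b)| +
          (Real.sqrt (X * (1 + Real.log X) ^ 3) *
            Real.sqrt ((((X + 1 : ℕ) : ℝ) / 2 ^ (K + σ) + 2) * (2 ^ (K + σ) / (2 * ((K₁ : ℝ) - 1)))) +
          3 * (Real.sqrt (X * (1 + Real.log X) ^ 3) *
            Real.sqrt ((((X + 1 : ℕ) : ℝ) / 2 ^ (K + σ) + 2) * (2 ^ (K + σ) / (2 * ((K₁ : ℝ) - 1)))))) := by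
        gcongr
        · exact hbox _ hSb2 hX2
        · exact hbox _ hSb1 hX1
    _ = _ := by ring



/-! ### The pair sum of the localised Walsh factor: the structural bound with the Fourier data plugged in -/

/-- The bound of `pairSum_block_le` for block `e` and window-sum majorant `J`.
[cite: Bourgain2013MoebiusWalsh, (2.25)–(2.27)] -/
def blockBound (R M K P₀ L N₀ N e : ℕ) (J : ℕ → ℝ) : ℝ :=
  2 * J (2 ^ e) * ((2 * R * L / (2 : ℝ) ^ P₀ + 2) *
    (blockGamma M K P₀ N e * J (confLen P₀ (1 / M + blockW K P₀ (N₀ + N) e)) +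
      ∑ i ∈ range (Nat.log 2 M + 1), min (blockGamma M K P₀ N e) ((N : ℝ) * M / 2 ^ (i + 1)) *
        J (confLen P₀ ((2 : ℝ) ^ (i + 1) / M + blockW K P₀ (N₀ + N) e))))

/-- `pairSum_block_le` in terms of `blockBound`. [cite: Bourgain2013MoebiusWalsh, (2.25)–(2.27)] -/
theorem pairSum_block_le_blockBound {a : ℤ → ℝ} (ha0 : ∀ k, 0 ≤ a k) {R M : ℕ} (hM : 0 < M)
    (K P₀ : ℕ) {ℓ : ℤ} (hℓ : ℓ ≠ 0) {L : ℕ} (hℓL : ℓ.natAbs ≤ L) (N₀ N e : ℕ) (J : ℕ → ℝ)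
    (hJ : ∀ (x : ℤ) (Λ : ℕ), 1 ≤ Λ → ∑ k ∈ Ico x (x + Λ), a k ≤ J Λ) :
    ∑ n ∈ Ico N₀ (N₀ + N), ∑ k ∈ Ioo (-(R : ℤ)) R, ∑ k' ∈ Ioo (-(R : ℤ)) R,
      (if InShortBlock K P₀ (N₀ + N) e k k' then a k * a k' * geomBound M (pairPhase K P₀ ℓ k k' n) else 0) ≤
      blockBound R M K P₀ L N₀ N e J :=
  pairSum_block_le ha0 hM K P₀ hℓ hℓL N₀ N e J hJ

/-- The Lemma-6 window majorant `J₆(Λ) = 4 (min(Λ, 2^P))^κ`. [cite: Bourgain2013MoebiusWalsh, Lemma 6] -/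
def windowBoundL6 (P : ℕ) (Λ : ℕ) : ℝ := 4 * ((min Λ (2 ^ P) : ℕ) : ℝ) ^ walshL1Exponent

/-- The sup-norm window majorant `J_∞(Λ) = 2·2^{-c₂ s} Λ`. [cite: Bourgain2013MoebiusWalsh, (2.9), (2.27)] -/
def windowBoundSup (s : ℕ) (Λ : ℕ) : ℝ := 2 * (2 : ℝ) ^ (-(walshSupExponent * s)) * Λ

set_option maxHeartbeats 1000000 in
/-- **The pair sum of `W_{S'}` for a shifted window — Bourgain 2013, (2.11)–(2.14), (2.23)–(2.27)
with the Fourier data of Lemmas 2, 5, 6 plugged in.** For `A ⊆ {K, …, K+σ-1}` (the truncated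
digit set `S'`, `|S'| = s`), `K₁ ≥ 1` with `4K₁ ≤ 2^K`, coefficients `a = |c|` of
`W = localisedWalshRe K σ K₁ A` (`R = 2K₁2^σ` frequencies), a lag `d·2^K` with `1 ≤ d ≤ L`, a
window of length `M ≥ 1` of the smooth variable and `N₀ ≤ n < N₀+N`:
`pairSum a R M K σ d N₀ N ≤ N η² (4K₁+2)(2^{v₂(d)+1}M + 2^σ(1+log 2^σ))`  (diagonal, `η = 2·2^{-c₂ s}`)
`+ A₁² ((log₂M+2)(2N + 64(N₀+N)) + 2M(4K₁N/2^K + 2))`  (long arcs, `A₁ = 4(K+2)2^{κσ}`)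
`+ ∑_{e < σ + log₂K₁ + 3} min(blockBound … e J₆, blockBound … e J_∞)`  (short blocks, both branches:
`J₆(Λ) = 4 min(Λ,2^{K+σ})^κ` from Lemma 6, `J_∞(Λ) = ηΛ` from Lemma 2).
The numerical choice between the branches ((2.26) vs (2.27)) and of `K₁ = 2^{t-1}`, `L`, `K` is
left to the type-II estimate. [cite: Bourgain2013MoebiusWalsh, (2.11)–(2.14), (2.23)–(2.27)] -/
theorem pairSum_localised_le {K σ K₁ : ℕ} (A : Finset (Fin (K + σ))) (hA : ∀ j ∈ A, K ≤ (j : ℕ))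
    (hK₁ : 1 ≤ K₁) (hKq : 4 * K₁ ≤ 2 ^ K) {M : ℕ} (hM : 0 < M) {d : ℕ} (hd : d ≠ 0) {L : ℕ}
    (hdL : d ≤ L) (N₀ N : ℕ) :
    pairSum (fun k => ‖localisedCoeff K σ K₁ A k‖) (2 * (K₁ * 2 ^ σ)) M K σ d N₀ N ≤
      N * (2 * (2 : ℝ) ^ (-(walshSupExponent * A.card))) ^ 2 *
        ((4 * (K₁ : ℝ) + 2) * (2 ^ (d.factorization 2 + 1) * M + 2 ^ σ * (1 + Real.log (2 ^ σ)))) +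
      (4 * ((K : ℝ) + 2) * (2 : ℝ) ^ (walshL1Exponent * σ)) ^ 2 *
        (((Nat.log 2 M : ℝ) + 2) * (2 * N + 64 * (N₀ + N : ℕ)) + 2 * M * (4 * K₁ * N / 2 ^ K + 2)) +
      ∑ e ∈ range (σ + Nat.log 2 K₁ + 3),
        min (blockBound (2 * (K₁ * 2 ^ σ)) M K σ L N₀ N e (windowBoundL6 (K + σ)))
            (blockBound (2 * (K₁ * 2 ^ σ)) M K σ L N₀ N e (windowBoundSup A.card)) := by
  set R : ℕ := 2 * (K₁ * 2 ^ σ) with hR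
  set a : ℤ → ℝ := fun k => ‖localisedCoeff K σ K₁ A k‖ with ha
  set η : ℝ := 2 * (2 : ℝ) ^ (-(walshSupExponent * A.card)) with hη
  set E : ℕ := σ + Nat.log 2 K₁ + 3 with hE
  have ha0 : ∀ k, 0 ≤ a k := fun k => norm_nonneg _
  have haη : ∀ k, a k ≤ η := fun k => norm_localisedCoeff_le_sup K σ K₁ A k
  have hℓ : (d : ℤ) ≠ 0 := by exact_mod_cast hd
  have hℓL : (d : ℤ).natAbs ≤ L := by rw [Int.natAbs_natCast]; exact hdL
  have hRP : 2 * R ≤ 2 ^ (K + σ) := by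
    rw [hR, pow_add]
    calc 2 * (2 * (K₁ * 2 ^ σ)) = (4 * K₁) * 2 ^ σ := by ring
      _ ≤ 2 ^ K * 2 ^ σ := Nat.mul_le_mul_right _ hKq
  have h2E : 2 * R ≤ 2 ^ E := by
    have h1 : K₁ < 2 ^ (Nat.log 2 K₁ + 1) := Nat.lt_pow_succ_log_self one_lt_two K₁
    calc 2 * R = 2 ^ σ * (4 * K₁) := by rw [hR]; ring
      _ ≤ 2 ^ σ * (4 * 2 ^ (Nat.log 2 K₁ + 1)) := Nat.mul_le_mul_left _ (Nat.mul_le_mul_left _ h1.le)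
      _ = 2 ^ E := by
          rw [hE, show σ + Nat.log 2 K₁ + 3 = σ + ((Nat.log 2 K₁ + 1) + 2) by ring, pow_add, pow_add]; ring
  -- the `ℓ¹` bound
  have hA₁ : ∑ k ∈ Ioo (-(R : ℤ)) R, a k ≤ 4 * ((K : ℝ) + 2) * (2 : ℝ) ^ (walshL1Exponent * σ) :=
    sum_Ioo_norm_localisedCoeff_le A hA hKq
  -- the two window majorants
  have hJsup : ∀ (x : ℤ) (Λ : ℕ), 1 ≤ Λ → ∑ k ∈ Ico x (x + Λ), a k ≤ windowBoundSup A.card Λ := by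
    intro x Λ _
    calc ∑ k ∈ Ico x (x + Λ), a k ≤ ∑ _k ∈ Ico x (x + Λ), η := Finset.sum_le_sum fun k _ => haη k
      _ = windowBoundSup A.card Λ := by
          rw [Finset.sum_const, Int.card_Ico, nsmul_eq_mul, show x + Λ - x = (Λ : ℤ) by ring, Int.toNat_natCast,
            windowBoundSup, hη]; ring
  have hJ6 : ∀ (x : ℤ) (Λ : ℕ), 1 ≤ Λ → ∑ k ∈ Ico x (x + Λ), a k ≤ windowBoundL6 (K + σ) Λ := by
    intro x Λ hΛ1
    rcases le_or_gt Λ (2 ^ (K + σ)) with hΛ | hΛ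
    · rw [windowBoundL6, min_eq_left hΛ]
      exact sum_Ico_norm_localisedCoeff_le K σ K₁ A x hΛ1 hΛ
    · rw [windowBoundL6, min_eq_right hΛ.le]
      -- the support of `a` lies in `(-R, R) ⊆ [-R, -R + 2^P)`
      have hvan : ∀ k : ℤ, R ≤ k.natAbs → a k = 0 := fun k hk => by
        simp only [ha]; rw [localisedCoeff_eq_zero A (by rw [hR] at hk; exact hk), norm_zero]
      calc ∑ k ∈ Ico x (x + Λ), a k = ∑ k ∈ (Ico x (x + Λ)).filter (fun k : ℤ => k.natAbs < R), a k := by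
            rw [Finset.sum_filter]
            refine Finset.sum_congr rfl fun k _ => ?_
            split_ifs with h
            · rfl
            · exact hvan k (not_lt.mp h)
        _ ≤ ∑ k ∈ Ico (-(R : ℤ)) (-(R : ℤ) + (2 ^ (K + σ) : ℕ)), a k := by
            refine Finset.sum_le_sum_of_subset_of_nonneg ?_ fun k _ _ => ha0 k
            intro k hk
            rw [Finset.mem_filter] at hk
            rw [Finset.mem_Ico]
            have h2 : (2 * R : ℤ) ≤ ((2 ^ (K + σ) : ℕ) : ℤ) := by exact_mod_cast hRP
            omega
        _ ≤ 4 * (((2 ^ (K + σ) : ℕ)) : ℝ) ^ walshL1Exponent :=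
            sum_Ico_norm_localisedCoeff_le K σ K₁ A _ Nat.one_le_two_pow le_rfl
  -- the three structural bounds
  have hparts := pairSum_le_parts ha0 M K σ (d : ℤ) N₀ N h2E
  have hdiag := pairSum_diag_le ha0 haη R M K σ hℓ N₀ N
  have hlong := pairSum_long_le ha0 hA₁ hM K σ (d : ℤ) N₀ N
  have hblocks : ∀ e, ∑ n ∈ Ico N₀ (N₀ + N), ∑ k ∈ Ioo (-(R : ℤ)) R, ∑ k' ∈ Ioo (-(R : ℤ)) R,
      (if InShortBlock K σ (N₀ + N) e k k' then a k * a k' * geomBound M (pairPhase K σ d k k' n) else 0) ≤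
      min (blockBound R M K σ L N₀ N e (windowBoundL6 (K + σ)))
          (blockBound R M K σ L N₀ N e (windowBoundSup A.card)) := fun e =>
    le_min (pairSum_block_le_blockBound ha0 hM K σ hℓ hℓL N₀ N e _ hJ6)
      (pairSum_block_le_blockBound ha0 hM K σ hℓ hℓL N₀ N e _ hJsup)
  -- numerical identities for the constants
  have hRσ : 2 * (R : ℝ) / 2 ^ σ = 4 * K₁ := by
    rw [hR]; push_cast; field_simp; ring
  have hRN : 2 * (R : ℝ) * N / 2 ^ (K + σ) = 4 * K₁ * N / 2 ^ K := by
    rw [hR, pow_add]; push_cast; field_simp; ring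
  have hfac : ((d : ℤ).natAbs.factorization 2) = d.factorization 2 := by rw [Int.natAbs_natCast]
  rw [hRσ, hfac] at hdiag
  rw [hRN] at hlong
  refine hparts.trans ?_
  refine add_le_add (add_le_add hdiag hlong) (Finset.sum_le_sum fun e _ => hblocks e)



/-! ### Numerical evaluation of the block bounds (Bourgain 2013, (2.25)–(2.27) with `L = 2^ρ`, `Δk ∼ 2^e`) -/

section Eval

/-- `confLen P₀ η ≤ 2η2^{P₀} + 1` for `η ≥ 0`. [folklore] -/
theorem confLen_le (P₀ : ℕ) {η : ℝ} (hη : 0 ≤ η) : (confLen P₀ η : ℝ) ≤ 2 * η * 2 ^ P₀ + 1 := by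
  unfold confLen; push_cast
  have := Nat.floor_le (by positivity : 0 ≤ 2 * η * (2 : ℝ) ^ P₀)
  linarith

/-- For a nonempty short block (`16(N₀+N)2^e ≤ 2^{K+P₀}`) the progression bound is
`Γ_e ≤ 5(log₂M+2) 2^{K+P₀}/2^e + 5M`. [cite: Bourgain2013MoebiusWalsh, (2.25)] -/
theorem blockGamma_le {M K P₀ N₀ N e : ℕ} (hne : 16 * (N₀ + N) * 2 ^ e ≤ 2 ^ (K + P₀)) :
    blockGamma M K P₀ N e ≤ 5 * ((Nat.log 2 M : ℝ) + 2) * (2 : ℝ) ^ (K + P₀) / 2 ^ e + 5 * M := by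
  unfold blockGamma
  have hI : (0 : ℝ) ≤ (Nat.log 2 M : ℝ) + 2 := by positivity
  have hDe : (0 : ℝ) < 2 ^ e := by positivity
  have hne' : 16 * ((N₀ + N : ℕ) : ℝ) * 2 ^ e ≤ 2 ^ (K + P₀) := by exact_mod_cast hne
  have hN : (2 : ℝ) * N ≤ 2 ^ (K + P₀) / 2 ^ e / 8 := by
    rw [le_div_iff₀ (by norm_num : (0:ℝ) < 8), le_div_iff₀ hDe]
    have : (N : ℝ) ≤ (N₀ + N : ℕ) := by exact_mod_cast Nat.le_add_left N N₀
    nlinarith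
  have h1 : ((Nat.log 2 M : ℝ) + 2) * (2 * N + 4 * 2 ^ (K + P₀) / 2 ^ e) ≤
      ((Nat.log 2 M : ℝ) + 2) * (5 * (2 ^ (K + P₀) / 2 ^ e)) := by
    refine mul_le_mul_of_nonneg_left ?_ hI
    have : 4 * (2 : ℝ) ^ (K + P₀) / 2 ^ e = 4 * (2 ^ (K + P₀) / 2 ^ e) := by ring
    rw [this]
    have h0 : (0 : ℝ) ≤ 2 ^ (K + P₀) / 2 ^ e := by positivity
    linarith
  have hM : (33 : ℝ) * M / 8 ≤ 5 * M := by
    have : (0 : ℝ) ≤ M := Nat.cast_nonneg M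
    linarith
  calc ((Nat.log 2 M : ℝ) + 2) * (2 * N + 4 * 2 ^ (K + P₀) / 2 ^ e) + 33 * M / 8
      ≤ ((Nat.log 2 M : ℝ) + 2) * (5 * (2 ^ (K + P₀) / 2 ^ e)) + 5 * M := add_le_add h1 hM
    _ = _ := by ring

/-- `min(a, b) ≤ √a √b` for `a, b ≥ 0`. [folklore] -/
theorem min_le_sqrt_mul_sqrt {a b : ℝ} (ha : 0 ≤ a) (hb : 0 ≤ b) : min a b ≤ Real.sqrt a * Real.sqrt b := by
  have hm : 0 ≤ min a b := le_min ha hb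
  have hsq : (min a b) ^ 2 ≤ a * b := by
    rcases le_total a b with h | h
    · rw [min_eq_left h, sq]; exact mul_le_mul_of_nonneg_left h ha
    · rw [min_eq_right h, sq]; exact mul_le_mul_of_nonneg_right h hb
  calc min a b = Real.sqrt ((min a b) ^ 2) := (Real.sqrt_sq hm).symm
    _ ≤ Real.sqrt (a * b) := Real.sqrt_le_sqrt hsq
    _ = Real.sqrt a * Real.sqrt b := Real.sqrt_mul ha b

/-- `√(a + b) ≤ √a + √b` for `a, b ≥ 0`. [folklore] -/
theorem sqrt_add_le_sqrt_add {a b : ℝ} (ha : 0 ≤ a) (hb : 0 ≤ b) :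
    Real.sqrt (a + b) ≤ Real.sqrt a + Real.sqrt b := by
  have h : a + b ≤ (Real.sqrt a + Real.sqrt b) ^ 2 := by
    rw [add_sq, Real.sq_sqrt ha, Real.sq_sqrt hb]
    have : 0 ≤ 2 * Real.sqrt a * Real.sqrt b := by positivity
    linarith
  calc Real.sqrt (a + b) ≤ Real.sqrt ((Real.sqrt a + Real.sqrt b) ^ 2) := Real.sqrt_le_sqrt h
    _ = Real.sqrt a + Real.sqrt b := Real.sqrt_sq (by positivity)

set_option maxHeartbeats 1000000 in
/-- **The sup branch ((2.27)) of a nonempty short block**: if `16(N₀+N)2^e ≤ 2^{K+σ}` and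
`β_e = 2^e(N₀+N)/2^K < y`, then with `η = 2·2^{-c₂ s}`, `C_R = 2RL/2^σ + 2`, `I = log₂ M`,
`2^σ ≤ L'M`, `N₀ ≤ N`, `2^K ≤ N`:
`blockBound … e J_∞ ≤ MN · 2η²C_R [(I+2)(5(I+2)L' + 5y/N)(2L' + 4y + 1) + 2(I+1)L'y]`.
[cite: Bourgain2013MoebiusWalsh, (2.27)] -/
theorem blockBound_sup_le (R M K σ L N₀ N e s : ℕ) (hM : 0 < M) {y L' : ℝ} (hy : 1 ≤ y)
    (hL' : 1 ≤ L') (hσL : (2 : ℝ) ^ σ ≤ L' * M) (hN₀ : N₀ ≤ N) (hKN : 2 ^ K ≤ N)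
    (hne : 16 * (N₀ + N) * 2 ^ e ≤ 2 ^ (K + σ))
    (hβ : (2 : ℝ) ^ e * ((N₀ + N : ℕ) : ℝ) / 2 ^ K < y) :
    blockBound R M K σ L N₀ N e (windowBoundSup s) ≤
      M * N * (2 * (2 * (2 : ℝ) ^ (-(walshSupExponent * s))) ^ 2 * (2 * R * L / (2 : ℝ) ^ σ + 2) *
        (((Nat.log 2 M : ℝ) + 2) * (5 * ((Nat.log 2 M : ℝ) + 2) * L' + 5 * y / N) * (2 * L' + 4 * y + 1) +
          2 * ((Nat.log 2 M : ℝ) + 1) * L' * y)) := by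
  -- names
  set I : ℝ := (Nat.log 2 M : ℝ) with hI
  set η : ℝ := 2 * (2 : ℝ) ^ (-(walshSupExponent * s)) with hη
  set CR : ℝ := 2 * R * L / (2 : ℝ) ^ σ + 2 with hCR
  set Q : ℝ := (2 : ℝ) ^ σ with hQ
  set TK : ℝ := (2 : ℝ) ^ K with hTK
  set De : ℝ := (2 : ℝ) ^ e with hDe
  set Nt : ℝ := ((N₀ + N : ℕ) : ℝ) with hNt
  set β : ℝ := De * Nt / TK with hβdef
  set Γ : ℝ := blockGamma M K σ N e with hΓ
  set w : ℝ := blockW K σ (N₀ + N) e with hw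
  have hMr : (0 : ℝ) < M := by exact_mod_cast hM
  have hNr : (1 : ℝ) ≤ N := by
    have : 1 ≤ N := le_trans Nat.one_le_two_pow hKN
    exact_mod_cast this
  have hQ0 : 0 < Q := by rw [hQ]; positivity
  have hTK0 : 0 < TK := by rw [hTK]; positivity
  have hDe0 : 0 < De := by rw [hDe]; positivity
  have hNt0 : 0 < Nt := by rw [hNt]; push_cast; linarith
  have hη0 : 0 ≤ η := by rw [hη]; positivity
  have hCR0 : 0 ≤ CR := by rw [hCR]; positivity
  have hI0 : 0 ≤ I := by rw [hI]; positivity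
  have hΓ0 : 0 ≤ Γ := blockGamma_nonneg _ _ _ _ _
  have hw0 : 0 ≤ w := blockW_nonneg _ _ _ _
  have hβ0 : 0 ≤ β := by rw [hβdef]; positivity
  have hTKN : TK ≤ N := by rw [hTK]; exact_mod_cast hKN
  have hNNt : (N : ℝ) ≤ Nt := by rw [hNt]; exact_mod_cast Nat.le_add_left N N₀
  have hNt2 : Nt ≤ 2 * N := by
    have h0 : (N₀ : ℝ) ≤ N := by exact_mod_cast hN₀
    rw [hNt]; push_cast; linarith
  have hP2 : (2 : ℝ) ^ (K + σ) = TK * Q := by rw [pow_add]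
  have hQM : Q / M ≤ L' := by rw [div_le_iff₀ hMr]; exact hσL
  -- `2wQ = 4β`
  have hwQ : 2 * w * Q = 4 * β := by
    rw [hw, blockW, hβdef, hP2, pow_succ, ← hDe, ← hNt]; field_simp; ring
  -- `De ≤ y`
  have hDey : De ≤ y := by
    have h1 : De ≤ β := by
      rw [hβdef, le_div_iff₀ hTK0]
      exact mul_le_mul_of_nonneg_left (hTKN.trans hNNt) hDe0.le
    have h2 : β < y := by rw [hβdef]; exact hβ
    linarith
  -- `Γ ≤ 5(I+2) TK Q/De + 5M`
  have hΓle : Γ ≤ 5 * (I + 2) * (TK * Q) / De + 5 * M := by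
    have := blockGamma_le (M := M) hne; rw [hP2] at this; rw [hΓ, hI]; exact this
  have hDeΓ : De * Γ ≤ 5 * (I + 2) * (N * Q) + 5 * M * y := by
    calc De * Γ ≤ De * (5 * (I + 2) * (TK * Q) / De + 5 * M) := mul_le_mul_of_nonneg_left hΓle hDe0.le
      _ = 5 * (I + 2) * (TK * Q) + 5 * M * De := by field_simp
      _ ≤ 5 * (I + 2) * (N * Q) + 5 * M * y := by
          gcongr
  -- the confinement lengths
  have hΛ0 : (confLen σ (1 / M + w) : ℝ) ≤ 2 * Q / M + 4 * β + 1 := by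
    refine (confLen_le σ (by positivity)).trans (le_of_eq ?_)
    rw [← hQ]; rw [show 2 * (1 / (M : ℝ) + w) * Q = 2 * Q / M + 2 * w * Q by ring, hwQ]
  have hΛi : ∀ i : ℕ, (confLen σ ((2 : ℝ) ^ (i + 1) / M + w) : ℝ) ≤ 2 ^ (i + 2) * Q / M + 4 * β + 1 := by
    intro i
    refine (confLen_le σ (by positivity)).trans (le_of_eq ?_)
    rw [← hQ, show 2 * ((2 : ℝ) ^ (i + 1) / M + w) * Q = 2 ^ (i + 2) * Q / M + 2 * w * Q by ring, hwQ]
  -- the inner sum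
  have hinner : Γ * (η * (confLen σ (1 / M + w) : ℝ)) +
      ∑ i ∈ range (Nat.log 2 M + 1), min Γ ((N : ℝ) * M / 2 ^ (i + 1)) *
        (η * (confLen σ ((2 : ℝ) ^ (i + 1) / M + w) : ℝ)) ≤
      η * ((I + 2) * Γ * (2 * Q / M + 4 * β + 1) + 2 * (I + 1) * (N * Q)) := by
    have hterm : ∀ i ∈ range (Nat.log 2 M + 1), min Γ ((N : ℝ) * M / 2 ^ (i + 1)) *
        (η * (confLen σ ((2 : ℝ) ^ (i + 1) / M + w) : ℝ)) ≤ η * (2 * (N * Q) + Γ * (4 * β + 1)) := by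
      intro i _
      have hmin0 : 0 ≤ min Γ ((N : ℝ) * M / 2 ^ (i + 1)) := le_min hΓ0 (by positivity)
      calc min Γ ((N : ℝ) * M / 2 ^ (i + 1)) * (η * (confLen σ ((2 : ℝ) ^ (i + 1) / M + w) : ℝ))
          ≤ min Γ ((N : ℝ) * M / 2 ^ (i + 1)) * (η * (2 ^ (i + 2) * Q / M + 4 * β + 1)) :=
            mul_le_mul_of_nonneg_left (mul_le_mul_of_nonneg_left (hΛi i) hη0) hmin0
        _ = η * (min Γ ((N : ℝ) * M / 2 ^ (i + 1)) * (2 ^ (i + 2) * Q / M) +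
              min Γ ((N : ℝ) * M / 2 ^ (i + 1)) * (4 * β + 1)) := by ring
        _ ≤ η * (((N : ℝ) * M / 2 ^ (i + 1)) * (2 ^ (i + 2) * Q / M) + Γ * (4 * β + 1)) := by
            refine mul_le_mul_of_nonneg_left (add_le_add ?_ ?_) hη0
            · exact mul_le_mul_of_nonneg_right (min_le_right _ _) (by positivity)
            · exact mul_le_mul_of_nonneg_right (min_le_left _ _) (by positivity)
        _ = η * (2 * (N * Q) + Γ * (4 * β + 1)) := by
            congr 1; rw [pow_succ, pow_succ]; field_simp; ring
    calc Γ * (η * (confLen σ (1 / M + w) : ℝ)) +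
          ∑ i ∈ range (Nat.log 2 M + 1), min Γ ((N : ℝ) * M / 2 ^ (i + 1)) *
            (η * (confLen σ ((2 : ℝ) ^ (i + 1) / M + w) : ℝ))
        ≤ Γ * (η * (2 * Q / M + 4 * β + 1)) + ∑ _i ∈ range (Nat.log 2 M + 1), η * (2 * (N * Q) + Γ * (4 * β + 1)) :=
          add_le_add (mul_le_mul_of_nonneg_left (mul_le_mul_of_nonneg_left hΛ0 hη0) hΓ0)
            (Finset.sum_le_sum hterm)
      _ = η * (Γ * (2 * Q / M + 4 * β + 1) + (I + 1) * (2 * (N * Q) + Γ * (4 * β + 1))) := by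
          rw [Finset.sum_const, Finset.card_range, nsmul_eq_mul, hI]; push_cast; ring
      _ ≤ η * ((I + 2) * Γ * (2 * Q / M + 4 * β + 1) + 2 * (I + 1) * (N * Q)) := by
          refine mul_le_mul_of_nonneg_left ?_ hη0
          have h2QM0 : 0 ≤ 2 * Q / M := by positivity
          have h1 : Γ * (4 * β + 1) ≤ Γ * (2 * Q / M + 4 * β + 1) :=
            mul_le_mul_of_nonneg_left (by linarith) hΓ0
          nlinarith
  -- assemble
  have hmain : De * ((I + 2) * Γ * (2 * Q / M + 4 * β + 1) + 2 * (I + 1) * (N * Q)) ≤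
      M * N * ((I + 2) * (5 * (I + 2) * L' + 5 * y / N) * (2 * L' + 4 * y + 1) + 2 * (I + 1) * L' * y) := by
    have h1 : 2 * Q / M + 4 * β + 1 ≤ 2 * L' + 4 * y + 1 := by
      have : β < y := by rw [hβdef]; exact hβ
      have : 2 * Q / M = 2 * (Q / M) := by ring
      linarith
    have hNQ : N * Q ≤ L' * (M * N) := by
      calc (N : ℝ) * Q = N * M * (Q / M) := by field_simp
        _ ≤ N * M * L' := mul_le_mul_of_nonneg_left hQM (by positivity)
        _ = L' * (M * N) := by ring
    calc De * ((I + 2) * Γ * (2 * Q / M + 4 * β + 1) + 2 * (I + 1) * (N * Q))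
        = (I + 2) * (De * Γ) * (2 * Q / M + 4 * β + 1) + 2 * (I + 1) * (N * Q) * De := by ring
      _ ≤ (I + 2) * (5 * (I + 2) * (N * Q) + 5 * M * y) * (2 * L' + 4 * y + 1) + 2 * (I + 1) * (N * Q) * y := by
          gcongr
      _ ≤ (I + 2) * (5 * (I + 2) * (L' * (M * N)) + 5 * M * y) * (2 * L' + 4 * y + 1) +
            2 * (I + 1) * (L' * (M * N)) * y := by
          gcongr
      _ = M * N * ((I + 2) * (5 * (I + 2) * L' + 5 * y / N) * (2 * L' + 4 * y + 1) + 2 * (I + 1) * L' * y) := by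
          have hN0 : (N : ℝ) ≠ 0 := by linarith
          field_simp
  -- the block bound
  have hJe : windowBoundSup s (2 ^ e) = η * De := by
    rw [windowBoundSup, hη, hDe]; push_cast; ring
  unfold blockBound
  rw [hJe]
  simp only [windowBoundSup]
  rw [← hη, ← hCR, ← hΓ, ← hw]
  calc 2 * (η * De) * (CR * (Γ * (η * (confLen σ (1 / M + w) : ℝ)) +
        ∑ i ∈ range (Nat.log 2 M + 1), min Γ ((N : ℝ) * M / 2 ^ (i + 1)) *
          (η * (confLen σ ((2 : ℝ) ^ (i + 1) / M + w) : ℝ))))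
      ≤ 2 * (η * De) * (CR * (η * ((I + 2) * Γ * (2 * Q / M + 4 * β + 1) + 2 * (I + 1) * (N * Q)))) := by
        refine mul_le_mul_of_nonneg_left (mul_le_mul_of_nonneg_left hinner hCR0) (by positivity)
    _ = 2 * η ^ 2 * CR * (De * ((I + 2) * Γ * (2 * Q / M + 4 * β + 1) + 2 * (I + 1) * (N * Q))) := by ring
    _ ≤ 2 * η ^ 2 * CR * (M * N * ((I + 2) * (5 * (I + 2) * L' + 5 * y / N) * (2 * L' + 4 * y + 1) +
          2 * (I + 1) * L' * y)) := mul_le_mul_of_nonneg_left hmain (by positivity)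
    _ = _ := by ring

end Eval



section EvalL6

/-- **Exponent bookkeeping for `Δk ∼ 2^e ≥ y 2^K/(N₀+N)`**: for `0 < y`, `0 < T ≤ Nt`,
`yT/Nt ≤ D`, `s ≤ 0 ≤ s + u`: `D^s T^u Nt^v ≤ y^s Nt^{u+v}`. [folklore] -/
theorem rpow_block_key {D T Nt y s u v : ℝ} (hy : 0 < y) (hT : 0 < T) (hTN : T ≤ Nt)
    (hD : y * T / Nt ≤ D) (hs : s ≤ 0) (hsu : 0 ≤ s + u) :
    D ^ s * T ^ u * Nt ^ v ≤ y ^ s * Nt ^ (u + v) := by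
  have hNt : 0 < Nt := lt_of_lt_of_le hT hTN
  have hq : 0 < y * T / Nt := by positivity
  have hD0 : 0 < D := lt_of_lt_of_le hq hD
  -- `D^s ≤ (yT/Nt)^s = y^s T^s Nt^{-s}`
  have h1 : D ^ s ≤ y ^ s * T ^ s * Nt ^ (-s) := by
    calc D ^ s ≤ (y * T / Nt) ^ s := Real.rpow_le_rpow_of_nonpos hq hD hs
      _ = y ^ s * T ^ s * Nt ^ (-s) := by
          rw [Real.div_rpow (by positivity) hNt.le, Real.mul_rpow hy.le hT.le, Real.rpow_neg hNt.le]
          ring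
  have h2 : T ^ (s + u) ≤ Nt ^ (s + u) := Real.rpow_le_rpow hT.le hTN hsu
  calc D ^ s * T ^ u * Nt ^ v ≤ (y ^ s * T ^ s * Nt ^ (-s)) * T ^ u * Nt ^ v := by
        gcongr
    _ = y ^ s * T ^ (s + u) * Nt ^ (v - s) := by
        rw [Real.rpow_add hT, Real.rpow_sub hNt, Real.rpow_neg hNt.le]; field_simp
    _ ≤ y ^ s * Nt ^ (s + u) * Nt ^ (v - s) := by gcongr
    _ = y ^ s * Nt ^ (u + v) := by
        have e : Nt ^ (s + u) * Nt ^ (v - s) = Nt ^ (u + v) := by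
          rw [show u + v = (s + u) + (v - s) by ring]
          exact (Real.rpow_add hNt _ _).symm
        rw [mul_assoc, e]

/-- `x^κ ≤ x` for `x ≥ 1`, `κ ≤ 1`. [folklore] -/
theorem rpow_le_self_of_one_le {x κ : ℝ} (hx : 1 ≤ x) (hκ : κ ≤ 1) : x ^ κ ≤ x := by
  calc x ^ κ ≤ x ^ (1 : ℝ) := Real.rpow_le_rpow_of_exponent_le hx hκ
    _ = x := Real.rpow_one x

/-- `(2^i)^κ / √(2^{i+1}) ≤ 1` for `κ ≤ 1/2`. [folklore] -/
theorem two_pow_rpow_div_sqrt_le {κ : ℝ} (hκ : κ ≤ 1 / 2) (i : ℕ) :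
    ((2 : ℝ) ^ i) ^ κ * Real.sqrt (1 / 2 ^ (i + 1)) ≤ 1 := by
  have h2i : (1 : ℝ) ≤ 2 ^ i := one_le_pow₀ (by norm_num)
  have h1 : ((2 : ℝ) ^ i) ^ κ ≤ ((2 : ℝ) ^ i) ^ (1 / 2 : ℝ) := Real.rpow_le_rpow_of_exponent_le h2i hκ
  have h2 : ((2 : ℝ) ^ i) ^ (1 / 2 : ℝ) = Real.sqrt (2 ^ i) := by rw [Real.sqrt_eq_rpow]
  have h3 : Real.sqrt (2 ^ i) * Real.sqrt (1 / 2 ^ (i + 1)) ≤ 1 := by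
    rw [← Real.sqrt_mul (by positivity), show (2 : ℝ) ^ i * (1 / 2 ^ (i + 1)) = 1 / 2 by
      rw [pow_succ]; field_simp]
    rw [Real.sqrt_le_one]; norm_num
  calc ((2 : ℝ) ^ i) ^ κ * Real.sqrt (1 / 2 ^ (i + 1)) ≤ Real.sqrt (2 ^ i) * Real.sqrt (1 / 2 ^ (i + 1)) := by
        rw [← h2]; exact mul_le_mul_of_nonneg_right h1 (Real.sqrt_nonneg _)
    _ ≤ 1 := h3

/-! #### The three terms of the Lemma-6 branch, over the reals

Common hypotheses: `κ ∈ (0, 1/2)`; `De = 2^e`, `TK = 2^K`, `Nt = N₀ + N ≤ 2N`, `Q = 2^σ ≤ L'M`,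
`TK ≤ Nt`, `β = De·Nt/TK ≥ y ≥ 1` (so `yTK/Nt ≤ De`), the block is nonempty (`16 Nt De ≤ TK Q`),
and `Γ ≤ 5(I+2) TK Q/De + 5M` (`blockGamma_le`). -/

/-- Term (a) of the Lemma-6 branch: `De^κ (I+2) Γ (4β+1)^κ ≤ MN (50(I+2)² L' y^{2κ-1} + 25(I+2)(L'M)^{2κ}/N)`.
[cite: Bourgain2013MoebiusWalsh, (2.25)] -/
theorem blockL6_termA {κ De TK Nt Q M N I L' y Γ β : ℝ} (hκ0 : 0 < κ) (hκh : κ ≤ 1 / 2) (hκ1 : κ ≤ 1)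
    (hM : 0 < M) (hN : 0 < N) (hNt2 : Nt ≤ 2 * N) (hTK0 : 0 < TK) (hTKNt : TK ≤ Nt) (hDe0 : 0 < De)
    (hQ0 : 0 < Q) (hQLM : Q ≤ L' * M) (hy : 1 ≤ y) (hI : 0 ≤ I) (hΓ0 : 0 ≤ Γ)
    (hβ : β = De * Nt / TK) (hβ1 : 1 ≤ β) (hDlow : y * TK / Nt ≤ De) (hne : 16 * Nt * De ≤ TK * Q)
    (hΓle : Γ ≤ 5 * (I + 2) * (TK * Q) / De + 5 * M) :
    De ^ κ * ((I + 2) * Γ * (4 * β + 1) ^ κ) ≤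
      M * N * (50 * (I + 2) ^ 2 * L' * y ^ (2 * κ - 1) + 25 * (I + 2) * (L' * M) ^ (2 * κ) / N) := by
  have hy0 : 0 < y := by linarith
  have hNt0 : 0 < Nt := lt_of_lt_of_le hTK0 hTKNt
  have hβ0 : 0 < β := by linarith
  have h4β : (4 * β + 1) ^ κ ≤ 5 * β ^ κ := by
    calc (4 * β + 1) ^ κ ≤ (5 * β) ^ κ := Real.rpow_le_rpow (by positivity) (by linarith) hκ0.le
      _ = 5 ^ κ * β ^ κ := Real.mul_rpow (by norm_num) hβ0.le
      _ ≤ 5 * β ^ κ := mul_le_mul_of_nonneg_right (rpow_le_self_of_one_le (by norm_num) hκ1) (by positivity)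
  have ha1 : β ^ κ * De ^ (κ - 1) * (TK * Q) ≤ 2 * y ^ (2 * κ - 1) * (N * Q) := by
    have e1 : β ^ κ * De ^ (κ - 1) * (TK * Q) = (De ^ (2 * κ - 1) * TK ^ (1 - κ) * Nt ^ κ) * Q := by
      rw [hβ, Real.div_rpow (by positivity) hTK0.le, Real.mul_rpow hDe0.le hNt0.le]
      have h1 : De ^ (2 * κ - 1) = De ^ κ * De ^ (κ - 1) := by
        rw [← Real.rpow_add hDe0]; ring_nf
      have h2 : TK ^ (1 - κ) = TK / TK ^ κ := by
        rw [Real.rpow_sub hTK0, Real.rpow_one]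
      rw [h1, h2]; field_simp
    rw [e1]
    have hk := rpow_block_key (s := 2 * κ - 1) (u := 1 - κ) (v := κ) hy0 hTK0 hTKNt hDlow
      (by linarith) (by linarith)
    rw [show 1 - κ + κ = (1 : ℝ) by ring, Real.rpow_one] at hk
    calc De ^ (2 * κ - 1) * TK ^ (1 - κ) * Nt ^ κ * Q ≤ y ^ (2 * κ - 1) * Nt * Q :=
          mul_le_mul_of_nonneg_right hk hQ0.le
      _ ≤ y ^ (2 * κ - 1) * (2 * N) * Q := by gcongr
      _ = 2 * y ^ (2 * κ - 1) * (N * Q) := by ring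
  have ha2 : (De * β) ^ κ ≤ (L' * M) ^ (2 * κ) := by
    have h1 : De * β ≤ (L' * M) ^ 2 := by
      have hDe1 : De ≤ TK * Q / (16 * Nt) := by
        rw [le_div_iff₀ (by positivity)]; linarith [hne]
      have hq2 : Q ^ 2 ≤ (L' * M) ^ 2 := pow_le_pow_left₀ hQ0.le hQLM 2
      calc De * β = De * De * Nt / TK := by rw [hβ]; ring
        _ ≤ (TK * Q / (16 * Nt)) * (TK * Q / (16 * Nt)) * Nt / TK := by
            refine div_le_div_of_nonneg_right (mul_le_mul_of_nonneg_right
              (mul_le_mul hDe1 hDe1 hDe0.le (by positivity)) hNt0.le) hTK0.le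
        _ = TK * Q ^ 2 / (256 * Nt) := by field_simp; ring
        _ ≤ Q ^ 2 := by
            rw [div_le_iff₀ (by positivity)]
            calc TK * Q ^ 2 ≤ (256 * Nt) * Q ^ 2 := mul_le_mul_of_nonneg_right (by linarith) (sq_nonneg _)
              _ = Q ^ 2 * (256 * Nt) := by ring
        _ ≤ (L' * M) ^ 2 := hq2
    calc (De * β) ^ κ ≤ ((L' * M) ^ 2) ^ κ := Real.rpow_le_rpow (by positivity) h1 hκ0.le
      _ = (L' * M) ^ (2 * κ) := by
          rw [show ((L' * M) ^ 2 : ℝ) = (L' * M) ^ ((2 : ℕ) : ℝ) by rw [Real.rpow_natCast],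
            ← Real.rpow_mul (by nlinarith)]; norm_num
  have h1 : De ^ κ * ((I + 2) * Γ * (4 * β + 1) ^ κ) ≤ (I + 2) * 5 * (De ^ κ * β ^ κ * Γ) := by
    calc De ^ κ * ((I + 2) * Γ * (4 * β + 1) ^ κ) = (De ^ κ * ((I + 2) * Γ)) * (4 * β + 1) ^ κ := by ring
      _ ≤ (De ^ κ * ((I + 2) * Γ)) * (5 * β ^ κ) := mul_le_mul_of_nonneg_left h4β (by positivity)
      _ = (I + 2) * 5 * (De ^ κ * β ^ κ * Γ) := by ring
  have h2 : De ^ κ * β ^ κ * Γ ≤ 5 * (I + 2) * (β ^ κ * De ^ (κ - 1) * (TK * Q)) + 5 * M * (De * β) ^ κ := by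
    have e1 : De ^ κ * β ^ κ * (5 * (I + 2) * (TK * Q) / De) = 5 * (I + 2) * (β ^ κ * De ^ (κ - 1) * (TK * Q)) := by
      rw [Real.rpow_sub hDe0, Real.rpow_one]; field_simp
    have e2 : De ^ κ * β ^ κ * (5 * M) = 5 * M * (De * β) ^ κ := by
      rw [Real.mul_rpow hDe0.le hβ0.le]; ring
    calc De ^ κ * β ^ κ * Γ ≤ De ^ κ * β ^ κ * (5 * (I + 2) * (TK * Q) / De + 5 * M) :=
          mul_le_mul_of_nonneg_left hΓle (by positivity)
      _ = _ := by rw [mul_add, e1, e2]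
  calc De ^ κ * ((I + 2) * Γ * (4 * β + 1) ^ κ) ≤ (I + 2) * 5 * (De ^ κ * β ^ κ * Γ) := h1
    _ ≤ (I + 2) * 5 * (5 * (I + 2) * (2 * y ^ (2 * κ - 1) * (N * Q)) + 5 * M * (L' * M) ^ (2 * κ)) := by
        refine mul_le_mul_of_nonneg_left (h2.trans ?_) (by positivity)
        gcongr
    _ ≤ (I + 2) * 5 * (5 * (I + 2) * (2 * y ^ (2 * κ - 1) * (N * (L' * M))) + 5 * M * (L' * M) ^ (2 * κ)) := by
        gcongr
    _ = M * N * (50 * (I + 2) ^ 2 * L' * y ^ (2 * κ - 1) + 25 * (I + 2) * (L' * M) ^ (2 * κ) / N) := by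
        rw [mul_add (M * N) (50 * (I + 2) ^ 2 * L' * y ^ (2 * κ - 1)) (25 * (I + 2) * (L' * M) ^ (2 * κ) / N),
          show M * N * (25 * (I + 2) * (L' * M) ^ (2 * κ) / N) = 25 * (I + 2) * (L' * M) ^ (2 * κ) * M by
            field_simp]
        ring

/-- Term (b) of the Lemma-6 branch: `De^κ Γ (2Q/M)^κ ≤ MN (20(I+2) L'² y^{κ-1} + 10 L'(L'M)^κ/N)`.
[cite: Bourgain2013MoebiusWalsh, (2.25)] -/
theorem blockL6_termB {κ De TK Nt Q M N I L' y Γ : ℝ} (hκ0 : 0 < κ) (hκ1 : κ ≤ 1)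
    (hM : 0 < M) (hN : 0 < N) (hNt2 : Nt ≤ 2 * N) (hTK0 : 0 < TK) (hTKNt : TK ≤ Nt) (hDe0 : 0 < De)
    (hQ0 : 0 < Q) (hQLM : Q ≤ L' * M) (hy : 1 ≤ y) (hL' : 1 ≤ L') (hI : 0 ≤ I)
    (hDlow : y * TK / Nt ≤ De) (hDeLM : De ≤ L' * M)
    (hΓle : Γ ≤ 5 * (I + 2) * (TK * Q) / De + 5 * M) :
    De ^ κ * (Γ * (2 * Q / M) ^ κ) ≤
      M * N * (20 * (I + 2) * L' ^ 2 * y ^ (κ - 1) + 10 * L' * (L' * M) ^ κ / N) := by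
  have hy0 : 0 < y := by linarith
  have hNt0 : 0 < Nt := lt_of_lt_of_le hTK0 hTKNt
  have hQM : Q / M ≤ L' := by rw [div_le_iff₀ hM]; exact hQLM
  have h2QM : (2 * Q / M) ^ κ ≤ 2 * L' := by
    have h0 : 2 * Q / M ≤ 2 * L' := by
      have e : 2 * Q / M = 2 * (Q / M) := by ring
      rw [e]; linarith
    have h1 : (2 * Q / M) ^ κ ≤ (2 * L') ^ κ := Real.rpow_le_rpow (by positivity) h0 hκ0.le
    exact h1.trans (rpow_le_self_of_one_le (by linarith) hκ1)
  have hb1 : De ^ (κ - 1) * (TK * Q) ≤ 2 * y ^ (κ - 1) * (N * Q) := by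
    have hk := rpow_block_key (s := κ - 1) (u := 1) (v := 0) hy0 hTK0 hTKNt hDlow (by linarith) (by linarith)
    rw [Real.rpow_one, Real.rpow_zero, mul_one, show (1 : ℝ) + 0 = 1 by norm_num, Real.rpow_one] at hk
    calc De ^ (κ - 1) * (TK * Q) = (De ^ (κ - 1) * TK) * Q := by ring
      _ ≤ y ^ (κ - 1) * Nt * Q := mul_le_mul_of_nonneg_right hk hQ0.le
      _ ≤ y ^ (κ - 1) * (2 * N) * Q := by gcongr
      _ = 2 * y ^ (κ - 1) * (N * Q) := by ring
  have hDeκ : De ^ κ ≤ (L' * M) ^ κ := Real.rpow_le_rpow hDe0.le hDeLM hκ0.le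
  have h1 : De ^ κ * Γ ≤ 5 * (I + 2) * (De ^ (κ - 1) * (TK * Q)) + 5 * M * De ^ κ := by
    have e1 : De ^ κ * (5 * (I + 2) * (TK * Q) / De) = 5 * (I + 2) * (De ^ (κ - 1) * (TK * Q)) := by
      rw [Real.rpow_sub hDe0, Real.rpow_one]; field_simp
    calc De ^ κ * Γ ≤ De ^ κ * (5 * (I + 2) * (TK * Q) / De + 5 * M) := mul_le_mul_of_nonneg_left hΓle (by positivity)
      _ = _ := by rw [mul_add, e1]; ring
  calc De ^ κ * (Γ * (2 * Q / M) ^ κ) = (De ^ κ * Γ) * (2 * Q / M) ^ κ := by ring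
    _ ≤ (5 * (I + 2) * (2 * y ^ (κ - 1) * (N * Q)) + 5 * M * (L' * M) ^ κ) * (2 * L') := by
        refine mul_le_mul (h1.trans ?_) h2QM (by positivity) (by positivity)
        gcongr
    _ ≤ (5 * (I + 2) * (2 * y ^ (κ - 1) * (N * (L' * M))) + 5 * M * (L' * M) ^ κ) * (2 * L') := by
        gcongr
    _ = M * N * (20 * (I + 2) * L' ^ 2 * y ^ (κ - 1) + 10 * L' * (L' * M) ^ κ / N) := by
        rw [mul_add (M * N) (20 * (I + 2) * L' ^ 2 * y ^ (κ - 1)) (10 * L' * (L' * M) ^ κ / N),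
          show M * N * (10 * L' * (L' * M) ^ κ / N) = 10 * L' * (L' * M) ^ κ * M by field_simp]
        ring

/-- Term (c) of the Lemma-6 branch:
`De^κ (I+1)(4Q/M)^κ √(ΓNM) ≤ MN (13(I+2)² L'² y^{κ-1/2} + 9(I+2) L'(L'M)^κ/√N)`.
[cite: Bourgain2013MoebiusWalsh, (2.25)] -/
theorem blockL6_termC {κ De TK Nt Q M N I L' y Γ : ℝ} (hκ0 : 0 < κ) (hκh : κ ≤ 1 / 2) (hκ1 : κ ≤ 1)
    (hM : 0 < M) (hN : 0 < N) (hNt2 : Nt ≤ 2 * N) (hTK0 : 0 < TK) (hTKNt : TK ≤ Nt) (hDe0 : 0 < De)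
    (hQ0 : 0 < Q) (hQLM : Q ≤ L' * M) (hy : 1 ≤ y) (hL' : 1 ≤ L') (hI : 0 ≤ I)
    (hDlow : y * TK / Nt ≤ De) (hDeLM : De ≤ L' * M)
    (hΓle : Γ ≤ 5 * (I + 2) * (TK * Q) / De + 5 * M) :
    De ^ κ * ((I + 1) * (4 * Q / M) ^ κ * Real.sqrt (Γ * (N * M))) ≤
      M * N * (13 * (I + 2) ^ 2 * L' ^ 2 * y ^ (κ - 1 / 2) + 9 * (I + 2) * L' * (L' * M) ^ κ / Real.sqrt N) := by
  have hy0 : 0 < y := by linarith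
  have hNt0 : 0 < Nt := lt_of_lt_of_le hTK0 hTKNt
  have hQM : Q / M ≤ L' := by rw [div_le_iff₀ hM]; exact hQLM
  have h4QM : (4 * Q / M) ^ κ ≤ 4 * L' := by
    have h0 : 4 * Q / M ≤ 4 * L' := by
      have e : 4 * Q / M = 4 * (Q / M) := by ring
      rw [e]; linarith
    have h1 : (4 * Q / M) ^ κ ≤ (4 * L') ^ κ := Real.rpow_le_rpow (by positivity) h0 hκ0.le
    exact h1.trans (rpow_le_self_of_one_le (by linarith) hκ1)
  have hDeκ : De ^ κ ≤ (L' * M) ^ κ := Real.rpow_le_rpow hDe0.le hDeLM hκ0.le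
  have hc1 : De ^ (κ - 1 / 2) * Real.sqrt (TK * Q * (N * M)) ≤ y ^ (κ - 1 / 2) * N * Real.sqrt (2 * (L' * M) * M) := by
    have hk := rpow_block_key (s := κ - 1 / 2) (u := 1 / 2) (v := 0) hy0 hTK0 hTKNt hDlow (by linarith) (by linarith)
    rw [Real.rpow_zero, mul_one, show (1 : ℝ) / 2 + 0 = 1 / 2 by norm_num] at hk
    have e1 : Real.sqrt (TK * Q * (N * M)) = TK ^ (1 / 2 : ℝ) * Real.sqrt (Q * (N * M)) := by
      rw [Real.sqrt_eq_rpow, Real.sqrt_eq_rpow, ← Real.mul_rpow hTK0.le (by positivity)]; ring_nf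
    have e2 : Nt ^ (1 / 2 : ℝ) ≤ Real.sqrt (2 * N) := by
      rw [Real.sqrt_eq_rpow]; exact Real.rpow_le_rpow hNt0.le hNt2 (by norm_num)
    calc De ^ (κ - 1 / 2) * Real.sqrt (TK * Q * (N * M))
        = (De ^ (κ - 1 / 2) * TK ^ (1 / 2 : ℝ)) * Real.sqrt (Q * (N * M)) := by rw [e1]; ring
      _ ≤ (y ^ (κ - 1 / 2) * Nt ^ (1 / 2 : ℝ)) * Real.sqrt (Q * (N * M)) :=
          mul_le_mul_of_nonneg_right hk (Real.sqrt_nonneg _)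
      _ ≤ (y ^ (κ - 1 / 2) * Real.sqrt (2 * N)) * Real.sqrt ((L' * M) * (N * M)) := by
          gcongr
      _ = y ^ (κ - 1 / 2) * (Real.sqrt (2 * N) * Real.sqrt ((L' * M) * (N * M))) := by ring
      _ = y ^ (κ - 1 / 2) * (N * Real.sqrt (2 * (L' * M) * M)) := by
          congr 1
          rw [← Real.sqrt_mul (by positivity), show 2 * N * ((L' * M) * (N * M)) = N ^ 2 * (2 * (L' * M) * M) by ring,
            Real.sqrt_mul (by positivity), Real.sqrt_sq hN.le]
      _ = _ := by ring
  have hsqrtLM : Real.sqrt (2 * (L' * M) * M) ≤ Real.sqrt 2 * L' * M := by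
    have h1 : 2 * (L' * M) * M ≤ (Real.sqrt 2 * L' * M) ^ 2 := by
      rw [mul_pow, mul_pow, Real.sq_sqrt (by norm_num)]
      have h0 : 0 ≤ (L' - 1) * (L' * M ^ 2) := mul_nonneg (by linarith) (by positivity)
      nlinarith [h0]
    calc Real.sqrt (2 * (L' * M) * M) ≤ Real.sqrt ((Real.sqrt 2 * L' * M) ^ 2) := Real.sqrt_le_sqrt h1
      _ = Real.sqrt 2 * L' * M := Real.sqrt_sq (by positivity)
  -- `√(ΓNM) ≤ √(5(I+2)) √(TK Q N M / De) + √5 M √N`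
  have hΓsqrt : Real.sqrt (Γ * (N * M)) ≤ Real.sqrt (5 * (I + 2)) * Real.sqrt (TK * Q * (N * M) / De) +
      Real.sqrt 5 * M * Real.sqrt N := by
    have h1 : Γ * (N * M) ≤ 5 * (I + 2) * (TK * Q * (N * M) / De) + 5 * M * (N * M) := by
      calc Γ * (N * M) ≤ (5 * (I + 2) * (TK * Q) / De + 5 * M) * (N * M) :=
            mul_le_mul_of_nonneg_right hΓle (by positivity)
        _ = _ := by field_simp
    have e1 : Real.sqrt (5 * (I + 2) * (TK * Q * (N * M) / De)) =
        Real.sqrt (5 * (I + 2)) * Real.sqrt (TK * Q * (N * M) / De) := Real.sqrt_mul (by positivity) _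
    have e2 : Real.sqrt (5 * M * (N * M)) = Real.sqrt 5 * M * Real.sqrt N := by
      rw [show (5 : ℝ) * M * (N * M) = 5 * (M ^ 2 * N) by ring, Real.sqrt_mul (by norm_num),
        Real.sqrt_mul (by positivity), Real.sqrt_sq hM.le]; ring
    calc Real.sqrt (Γ * (N * M)) ≤ Real.sqrt (5 * (I + 2) * (TK * Q * (N * M) / De) + 5 * M * (N * M)) :=
          Real.sqrt_le_sqrt h1
      _ ≤ Real.sqrt (5 * (I + 2) * (TK * Q * (N * M) / De)) + Real.sqrt (5 * M * (N * M)) :=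
          sqrt_add_le_sqrt_add (by positivity) (by positivity)
      _ = _ := by rw [e1, e2]
  have hDeS : De ^ κ * Real.sqrt (TK * Q * (N * M) / De) = De ^ (κ - 1 / 2) * Real.sqrt (TK * Q * (N * M)) := by
    rw [Real.sqrt_div' _ hDe0.le, Real.sqrt_eq_rpow De, Real.rpow_sub hDe0]
    field_simp
  have hnum1 : Real.sqrt (5 * (I + 2)) * Real.sqrt 2 ≤ (13 / 4) * (I + 2) := by
    have hI2 : (1 : ℝ) ≤ I + 2 := by linarith
    have h1 : Real.sqrt (5 * (I + 2)) * Real.sqrt 2 = Real.sqrt (10 * (I + 2)) := by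
      rw [← Real.sqrt_mul (by positivity)]; congr 1; ring
    rw [h1]
    have h2 : 10 * (I + 2) ≤ ((13 / 4) * (I + 2)) ^ 2 := by nlinarith
    calc Real.sqrt (10 * (I + 2)) ≤ Real.sqrt (((13 / 4) * (I + 2)) ^ 2) := Real.sqrt_le_sqrt h2
      _ = (13 / 4) * (I + 2) := Real.sqrt_sq (by positivity)
  have hnum2 : Real.sqrt 5 ≤ 9 / 4 := by
    rw [Real.sqrt_le_left (by norm_num)]; norm_num
  have hsqN : Real.sqrt N * Real.sqrt N = N := Real.mul_self_sqrt hN.le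
  have hsqN0 : 0 < Real.sqrt N := Real.sqrt_pos.2 hN
  have hI1 : I + 1 ≤ I + 2 := by linarith
  calc De ^ κ * ((I + 1) * (4 * Q / M) ^ κ * Real.sqrt (Γ * (N * M)))
      = (I + 1) * (4 * Q / M) ^ κ * (De ^ κ * Real.sqrt (Γ * (N * M))) := by ring
    _ ≤ (I + 1) * (4 * L') * (De ^ κ * (Real.sqrt (5 * (I + 2)) * Real.sqrt (TK * Q * (N * M) / De) +
          Real.sqrt 5 * M * Real.sqrt N)) := by
        refine mul_le_mul (mul_le_mul_of_nonneg_left h4QM (by positivity))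
          (mul_le_mul_of_nonneg_left hΓsqrt (by positivity)) (by positivity) (by positivity)
    _ = (I + 1) * (4 * L') * (Real.sqrt (5 * (I + 2)) * (De ^ (κ - 1 / 2) * Real.sqrt (TK * Q * (N * M))) +
          Real.sqrt 5 * De ^ κ * M * Real.sqrt N) := by rw [← hDeS]; ring
    _ ≤ (I + 1) * (4 * L') * (Real.sqrt (5 * (I + 2)) * (y ^ (κ - 1 / 2) * N * (Real.sqrt 2 * L' * M)) +
          Real.sqrt 5 * (L' * M) ^ κ * M * Real.sqrt N) := by
        refine mul_le_mul_of_nonneg_left (add_le_add ?_ ?_) (by positivity)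
        · exact mul_le_mul_of_nonneg_left (hc1.trans (mul_le_mul_of_nonneg_left hsqrtLM (by positivity)))
            (Real.sqrt_nonneg _)
        · have h5 : 0 ≤ Real.sqrt 5 := Real.sqrt_nonneg _
          have := mul_le_mul_of_nonneg_left hDeκ h5
          exact mul_le_mul_of_nonneg_right (mul_le_mul_of_nonneg_right this hM.le) (Real.sqrt_nonneg _)
    _ = M * N * ((4 * (Real.sqrt (5 * (I + 2)) * Real.sqrt 2)) * (I + 1) * L' ^ 2 * y ^ (κ - 1 / 2)) +
          (4 * Real.sqrt 5) * (I + 1) * L' * (L' * M) ^ κ * (M * Real.sqrt N) := by ring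
    _ ≤ M * N * ((4 * ((13 / 4) * (I + 2))) * (I + 2) * L' ^ 2 * y ^ (κ - 1 / 2)) +
          (4 * (9 / 4)) * (I + 2) * L' * (L' * M) ^ κ * (M * Real.sqrt N) := by
        gcongr
    _ = M * N * (13 * (I + 2) ^ 2 * L' ^ 2 * y ^ (κ - 1 / 2) + 9 * (I + 2) * L' * (L' * M) ^ κ / Real.sqrt N) := by
        have e : M * Real.sqrt N = M * N / Real.sqrt N := by
          rw [eq_div_iff hsqN0.ne', mul_assoc, hsqN]
        rw [e]; ring

set_option maxHeartbeats 1000000 in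
/-- **The Lemma-6 branch ((2.25)–(2.26)) of a nonempty short block**: if `16(N₀+N)2^e ≤ 2^{K+σ}` and
`β_e = 2^e(N₀+N)/2^K ≥ y ≥ 1`, then with `C_R = 2RL/2^σ + 2`, `I = log₂ M`, `κ = walshL1Exponent`,
`2^σ ≤ L'M`, `N₀ ≤ N`, `2^K ≤ N`:
`blockBound … e J₆ ≤ MN · 32 C_R [83 (I+2)² L'² y^{κ-1/2} + 25(I+2)(L'M)^{2κ}/N + 19(I+2)L'(L'M)^κ/√N]`
(the saving `(Δk N/2^K)^{-c}` of (2.25) in the form `β^{κ-1/2}`, `1/2 - κ = 0.057…`; in the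
application `M ≤ N`, so that the last two terms are `≪ N^{κ-1/2}` as well).
[cite: Bourgain2013MoebiusWalsh, (2.25)–(2.26)] -/
theorem blockBound_L6_le (R M K σ L N₀ N e : ℕ) (hM : 0 < M) {y L' : ℝ} (hy : 1 ≤ y)
    (hL' : 1 ≤ L') (hσL : (2 : ℝ) ^ σ ≤ L' * M) (hN₀ : N₀ ≤ N) (hKN : 2 ^ K ≤ N)
    (hne : 16 * (N₀ + N) * 2 ^ e ≤ 2 ^ (K + σ))
    (hβ : y ≤ (2 : ℝ) ^ e * ((N₀ + N : ℕ) : ℝ) / 2 ^ K) :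
    blockBound R M K σ L N₀ N e (windowBoundL6 (K + σ)) ≤
      M * N * (32 * (2 * R * L / (2 : ℝ) ^ σ + 2) *
        (83 * ((Nat.log 2 M : ℝ) + 2) ^ 2 * L' ^ 2 * y ^ (walshL1Exponent - 1 / 2) +
          25 * ((Nat.log 2 M : ℝ) + 2) * (L' * M) ^ (2 * walshL1Exponent) / N +
          19 * ((Nat.log 2 M : ℝ) + 2) * L' * (L' * M) ^ walshL1Exponent / Real.sqrt N)) := by
  -- names
  set κ : ℝ := walshL1Exponent with hκdef
  set I : ℝ := (Nat.log 2 M : ℝ) with hI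
  set CR : ℝ := 2 * R * L / (2 : ℝ) ^ σ + 2 with hCR
  set Q : ℝ := (2 : ℝ) ^ σ with hQ
  set TK : ℝ := (2 : ℝ) ^ K with hTK
  set De : ℝ := (2 : ℝ) ^ e with hDe
  set Nt : ℝ := ((N₀ + N : ℕ) : ℝ) with hNt
  set β : ℝ := De * Nt / TK with hβdef
  set Γ : ℝ := blockGamma M K σ N e with hΓ
  set w : ℝ := blockW K σ (N₀ + N) e with hw
  have hκ0 : 0 < κ := walshL1Exponent_pos
  have hκhalf : κ < 1 / 2 := walshL1Exponent_lt_half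
  have hκ1 : κ ≤ 1 := by linarith
  have hMr : (0 : ℝ) < M := by exact_mod_cast hM
  have hM1 : (1 : ℝ) ≤ M := by exact_mod_cast hM
  have hNr : (1 : ℝ) ≤ N := by exact_mod_cast le_trans Nat.one_le_two_pow hKN
  have hN0 : (0 : ℝ) < N := by linarith
  have hQ0 : 0 < Q := by rw [hQ]; positivity
  have hTK0 : 0 < TK := by rw [hTK]; positivity
  have hDe0 : 0 < De := by rw [hDe]; positivity
  have hNNt : (N : ℝ) ≤ Nt := by rw [hNt]; exact_mod_cast Nat.le_add_left N N₀
  have hNt0 : 0 < Nt := lt_of_lt_of_le hN0 hNNt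
  have hNt2 : Nt ≤ 2 * N := by
    have h0 : (N₀ : ℝ) ≤ N := by exact_mod_cast hN₀
    rw [hNt]; push_cast; linarith
  have hTKN : TK ≤ N := by rw [hTK]; exact_mod_cast hKN
  have hTKNt : TK ≤ Nt := hTKN.trans hNNt
  have hy0 : 0 < y := by linarith
  have hCR0 : 0 ≤ CR := by rw [hCR]; positivity
  have hI0 : 0 ≤ I := by rw [hI]; positivity
  have hΓ0 : 0 ≤ Γ := blockGamma_nonneg _ _ _ _ _
  have hw0 : 0 ≤ w := blockW_nonneg _ _ _ _
  have hβy : y ≤ β := by rw [hβdef]; exact hβ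
  have hβ0 : 0 < β := lt_of_lt_of_le hy0 hβy
  have hβ1 : 1 ≤ β := hy.trans hβy
  have hP2 : (2 : ℝ) ^ (K + σ) = TK * Q := by rw [pow_add]
  have hQLM : Q ≤ L' * M := hσL
  -- `yTK/Nt ≤ De`
  have hDlow : y * TK / Nt ≤ De := by
    rw [div_le_iff₀ hNt0]
    have : y ≤ De * Nt / TK := hβy
    rw [le_div_iff₀ hTK0] at this
    linarith
  -- `De ≤ TK Q/(16 Nt) ≤ Q ≤ L'M`
  have hne' : 16 * Nt * De ≤ TK * Q := by
    rw [hNt, hDe, hTK, hQ, ← pow_add]; exact_mod_cast hne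
  have hDeQ : De ≤ Q := by
    have h1 : 16 * Nt * De ≤ Nt * Q := hne'.trans (mul_le_mul_of_nonneg_right hTKNt hQ0.le)
    have h2 : Nt * (16 * De) ≤ Nt * Q := by linarith
    have h3 : 16 * De ≤ Q := le_of_mul_le_mul_left h2 hNt0
    linarith
  have hDeLM : De ≤ L' * M := hDeQ.trans hQLM
  -- `2wQ = 4β`
  have hwQ : 2 * w * Q = 4 * β := by
    rw [hw, blockW, hβdef, hP2, pow_succ, ← hDe, ← hNt]; field_simp; ring
  -- `Γ ≤ 5(I+2) TK Q/De + 5M`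
  have hΓle : Γ ≤ 5 * (I + 2) * (TK * Q) / De + 5 * M := by
    have := blockGamma_le (M := M) hne; rw [hP2] at this; rw [hΓ, hI]; exact this
  -- the window majorant `J₆ ≤ 4 Λ^κ`
  have hJ6 : ∀ Λ : ℕ, windowBoundL6 (K + σ) Λ ≤ 4 * (Λ : ℝ) ^ κ := by
    intro Λ
    rw [windowBoundL6, ← hκdef]
    refine mul_le_mul_of_nonneg_left (Real.rpow_le_rpow (Nat.cast_nonneg _) ?_ hκ0.le) (by norm_num)
    exact_mod_cast min_le_left Λ (2 ^ (K + σ))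
  have hJ6e : windowBoundL6 (K + σ) (2 ^ e) ≤ 4 * De ^ κ := by
    have := hJ6 (2 ^ e); rwa [show (((2 ^ e : ℕ)) : ℝ) = De by rw [hDe]; push_cast; ring] at this
  -- confinement lengths and their `κ`-th powers
  have hΛ0 : (confLen σ (1 / M + w) : ℝ) ≤ 2 * Q / M + (4 * β + 1) := by
    refine (confLen_le σ (by positivity)).trans (le_of_eq ?_)
    rw [← hQ]; rw [show 2 * (1 / (M : ℝ) + w) * Q = 2 * Q / M + 2 * w * Q by ring, hwQ]; ring
  have hΛi : ∀ i : ℕ, (confLen σ ((2 : ℝ) ^ (i + 1) / M + w) : ℝ) ≤ 2 ^ (i + 2) * Q / M + (4 * β + 1) := by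
    intro i
    refine (confLen_le σ (by positivity)).trans (le_of_eq ?_)
    rw [← hQ, show 2 * ((2 : ℝ) ^ (i + 1) / M + w) * Q = 2 ^ (i + 2) * Q / M + 2 * w * Q by ring, hwQ]; ring
  have hsub : ∀ {x z : ℝ}, 0 ≤ x → 0 ≤ z → (x + z) ^ κ ≤ x ^ κ + z ^ κ := fun hx hz =>
    Real.rpow_add_le_add_rpow hx hz hκ0.le hκ1
  have h2QM0 : 0 ≤ 2 * Q / M := by positivity
  have h4β0 : 0 ≤ 4 * β + 1 := by positivity
  have hJΛ0 : windowBoundL6 (K + σ) (confLen σ (1 / M + w)) ≤ 4 * ((2 * Q / M) ^ κ + (4 * β + 1) ^ κ) := by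
    refine (hJ6 _).trans (mul_le_mul_of_nonneg_left ?_ (by norm_num))
    exact (Real.rpow_le_rpow (Nat.cast_nonneg _) hΛ0 hκ0.le).trans (hsub h2QM0 h4β0)
  have hJΛi : ∀ i : ℕ, windowBoundL6 (K + σ) (confLen σ ((2 : ℝ) ^ (i + 1) / M + w)) ≤
      4 * ((2 ^ (i + 2) * Q / M) ^ κ + (4 * β + 1) ^ κ) := by
    intro i
    refine (hJ6 _).trans (mul_le_mul_of_nonneg_left ?_ (by norm_num))
    exact (Real.rpow_le_rpow (Nat.cast_nonneg _) (hΛi i) hκ0.le).trans (hsub (by positivity) h4β0)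
  -- the inner sum: `X ≤ 4[(I+2)Γ(4β+1)^κ + Γ(2Q/M)^κ + (I+1)(4Q/M)^κ √(ΓNM)]`
  have hsum_i : ∀ i ∈ range (Nat.log 2 M + 1),
      min Γ ((N : ℝ) * M / 2 ^ (i + 1)) * windowBoundL6 (K + σ) (confLen σ ((2 : ℝ) ^ (i + 1) / M + w)) ≤
        4 * ((4 * Q / M) ^ κ * Real.sqrt (Γ * (N * M)) + Γ * (4 * β + 1) ^ κ) := by
    intro i _
    have hmin0 : 0 ≤ min Γ ((N : ℝ) * M / 2 ^ (i + 1)) := le_min hΓ0 (by positivity)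
    have hA : min Γ ((N : ℝ) * M / 2 ^ (i + 1)) * (2 ^ (i + 2) * Q / M) ^ κ ≤
        (4 * Q / M) ^ κ * Real.sqrt (Γ * (N * M)) := by
      have h1 : min Γ ((N : ℝ) * M / 2 ^ (i + 1)) ≤ Real.sqrt Γ * Real.sqrt ((N : ℝ) * M / 2 ^ (i + 1)) :=
        min_le_sqrt_mul_sqrt hΓ0 (by positivity)
      have h2 : (2 ^ (i + 2) * Q / M : ℝ) ^ κ = (4 * Q / M) ^ κ * ((2 : ℝ) ^ i) ^ κ := by
        rw [show (2 : ℝ) ^ (i + 2) * Q / M = (4 * Q / M) * 2 ^ i by rw [pow_add]; ring,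
          Real.mul_rpow (by positivity) (by positivity)]
      have h3 : Real.sqrt ((N : ℝ) * M / 2 ^ (i + 1)) = Real.sqrt (N * M) * Real.sqrt (1 / 2 ^ (i + 1)) := by
        rw [← Real.sqrt_mul (by positivity)]; congr 1; ring
      calc min Γ ((N : ℝ) * M / 2 ^ (i + 1)) * (2 ^ (i + 2) * Q / M) ^ κ
          ≤ (Real.sqrt Γ * Real.sqrt ((N : ℝ) * M / 2 ^ (i + 1))) * ((4 * Q / M) ^ κ * ((2 : ℝ) ^ i) ^ κ) := by
            rw [h2]; exact mul_le_mul_of_nonneg_right h1 (by positivity)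
        _ = (4 * Q / M) ^ κ * (Real.sqrt Γ * Real.sqrt (N * M)) * (((2 : ℝ) ^ i) ^ κ * Real.sqrt (1 / 2 ^ (i + 1))) := by
            rw [h3]; ring
        _ ≤ (4 * Q / M) ^ κ * (Real.sqrt Γ * Real.sqrt (N * M)) * 1 :=
            mul_le_mul_of_nonneg_left (two_pow_rpow_div_sqrt_le hκhalf.le i) (by positivity)
        _ = (4 * Q / M) ^ κ * Real.sqrt (Γ * (N * M)) := by rw [mul_one, ← Real.sqrt_mul hΓ0]
    calc min Γ ((N : ℝ) * M / 2 ^ (i + 1)) * windowBoundL6 (K + σ) (confLen σ ((2 : ℝ) ^ (i + 1) / M + w))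
        ≤ min Γ ((N : ℝ) * M / 2 ^ (i + 1)) * (4 * ((2 ^ (i + 2) * Q / M) ^ κ + (4 * β + 1) ^ κ)) :=
          mul_le_mul_of_nonneg_left (hJΛi i) hmin0
      _ = 4 * (min Γ ((N : ℝ) * M / 2 ^ (i + 1)) * (2 ^ (i + 2) * Q / M) ^ κ +
            min Γ ((N : ℝ) * M / 2 ^ (i + 1)) * (4 * β + 1) ^ κ) := by ring
      _ ≤ 4 * ((4 * Q / M) ^ κ * Real.sqrt (Γ * (N * M)) + Γ * (4 * β + 1) ^ κ) := by
          refine mul_le_mul_of_nonneg_left (add_le_add hA ?_) (by norm_num)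
          exact mul_le_mul_of_nonneg_right (min_le_left _ _) (by positivity)
  have hinner : Γ * windowBoundL6 (K + σ) (confLen σ (1 / M + w)) +
      ∑ i ∈ range (Nat.log 2 M + 1), min Γ ((N : ℝ) * M / 2 ^ (i + 1)) *
        windowBoundL6 (K + σ) (confLen σ ((2 : ℝ) ^ (i + 1) / M + w)) ≤
      4 * ((I + 2) * Γ * (4 * β + 1) ^ κ + Γ * (2 * Q / M) ^ κ + (I + 1) * (4 * Q / M) ^ κ * Real.sqrt (Γ * (N * M))) := by
    calc Γ * windowBoundL6 (K + σ) (confLen σ (1 / M + w)) +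
          ∑ i ∈ range (Nat.log 2 M + 1), min Γ ((N : ℝ) * M / 2 ^ (i + 1)) *
            windowBoundL6 (K + σ) (confLen σ ((2 : ℝ) ^ (i + 1) / M + w))
        ≤ Γ * (4 * ((2 * Q / M) ^ κ + (4 * β + 1) ^ κ)) +
            ∑ _i ∈ range (Nat.log 2 M + 1), 4 * ((4 * Q / M) ^ κ * Real.sqrt (Γ * (N * M)) + Γ * (4 * β + 1) ^ κ) :=
          add_le_add (mul_le_mul_of_nonneg_left hJΛ0 hΓ0) (Finset.sum_le_sum hsum_i)
      _ = 4 * ((I + 2) * Γ * (4 * β + 1) ^ κ + Γ * (2 * Q / M) ^ κ +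
            (I + 1) * (4 * Q / M) ^ κ * Real.sqrt (Γ * (N * M))) := by
          rw [Finset.sum_const, Finset.card_range, nsmul_eq_mul, hI]; push_cast; ring
  -- the three terms
  have hA := blockL6_termA (κ := κ) (I := I) (L' := L') hκ0 hκhalf.le hκ1 hMr hN0 hNt2 hTK0 hTKNt hDe0 hQ0
    hQLM hy hI0 hΓ0 hβdef hβ1 hDlow hne' hΓle
  have hB := blockL6_termB (κ := κ) (I := I) hκ0 hκ1 hMr hN0 hNt2 hTK0 hTKNt hDe0 hQ0 hQLM hy hL' hI0
    hDlow hDeLM hΓle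
  have hC := blockL6_termC (κ := κ) (I := I) hκ0 hκhalf.le hκ1 hMr hN0 hNt2 hTK0 hTKNt hDe0 hQ0 hQLM hy hL'
    hI0 hDlow hDeLM hΓle
  -- collect
  have hypow1 : y ^ (2 * κ - 1) ≤ y ^ (κ - 1 / 2) := Real.rpow_le_rpow_of_exponent_le hy (by linarith)
  have hypow2 : y ^ (κ - 1) ≤ y ^ (κ - 1 / 2) := Real.rpow_le_rpow_of_exponent_le hy (by linarith)
  have hL'2 : L' ≤ L' ^ 2 := by nlinarith
  have hsqrtN : Real.sqrt (N : ℝ) ≤ N := by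
    rw [Real.sqrt_le_left (by positivity)]; nlinarith
  have t1 : 50 * (I + 2) ^ 2 * L' * y ^ (2 * κ - 1) ≤ 50 * (I + 2) ^ 2 * L' ^ 2 * y ^ (κ - 1 / 2) := by
    gcongr
  have t2 : 20 * (I + 2) * L' ^ 2 * y ^ (κ - 1) ≤ 20 * (I + 2) ^ 2 * L' ^ 2 * y ^ (κ - 1 / 2) := by
    have hI2 : I + 2 ≤ (I + 2) ^ 2 := by nlinarith
    gcongr
  have t3 : 10 * L' * (L' * M) ^ κ / N ≤ 10 * (I + 2) * L' * (L' * M) ^ κ / Real.sqrt N := by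
    have h0 : 0 ≤ 10 * L' * (L' * M) ^ κ := by positivity
    have hI2 : (1 : ℝ) ≤ I + 2 := by linarith
    calc 10 * L' * (L' * M) ^ κ / N ≤ 10 * L' * (L' * M) ^ κ / Real.sqrt N :=
          div_le_div_of_nonneg_left h0 (Real.sqrt_pos.2 hN0) hsqrtN
      _ = 1 * (10 * L' * (L' * M) ^ κ) / Real.sqrt N := by ring
      _ ≤ (I + 2) * (10 * L' * (L' * M) ^ κ) / Real.sqrt N :=
          div_le_div_of_nonneg_right (mul_le_mul_of_nonneg_right hI2 h0) (Real.sqrt_nonneg _)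
      _ = 10 * (I + 2) * L' * (L' * M) ^ κ / Real.sqrt N := by ring
  have hMN0 : (0 : ℝ) ≤ M * N := by positivity
  have hY : De ^ κ * ((I + 2) * Γ * (4 * β + 1) ^ κ + Γ * (2 * Q / M) ^ κ +
      (I + 1) * (4 * Q / M) ^ κ * Real.sqrt (Γ * (N * M))) ≤
      M * N * (83 * (I + 2) ^ 2 * L' ^ 2 * y ^ (κ - 1 / 2) + 25 * (I + 2) * (L' * M) ^ (2 * κ) / N +
        19 * (I + 2) * L' * (L' * M) ^ κ / Real.sqrt N) := by
    calc De ^ κ * ((I + 2) * Γ * (4 * β + 1) ^ κ + Γ * (2 * Q / M) ^ κ +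
          (I + 1) * (4 * Q / M) ^ κ * Real.sqrt (Γ * (N * M)))
        = De ^ κ * ((I + 2) * Γ * (4 * β + 1) ^ κ) + De ^ κ * (Γ * (2 * Q / M) ^ κ) +
            De ^ κ * ((I + 1) * (4 * Q / M) ^ κ * Real.sqrt (Γ * (N * M))) := by ring
      _ ≤ M * N * (50 * (I + 2) ^ 2 * L' * y ^ (2 * κ - 1) + 25 * (I + 2) * (L' * M) ^ (2 * κ) / N) +
            M * N * (20 * (I + 2) * L' ^ 2 * y ^ (κ - 1) + 10 * L' * (L' * M) ^ κ / N) +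
            M * N * (13 * (I + 2) ^ 2 * L' ^ 2 * y ^ (κ - 1 / 2) + 9 * (I + 2) * L' * (L' * M) ^ κ / Real.sqrt N) :=
          add_le_add (add_le_add hA hB) hC
      _ = M * N * ((50 * (I + 2) ^ 2 * L' * y ^ (2 * κ - 1) + 25 * (I + 2) * (L' * M) ^ (2 * κ) / N) +
            (20 * (I + 2) * L' ^ 2 * y ^ (κ - 1) + 10 * L' * (L' * M) ^ κ / N) +
            (13 * (I + 2) ^ 2 * L' ^ 2 * y ^ (κ - 1 / 2) + 9 * (I + 2) * L' * (L' * M) ^ κ / Real.sqrt N)) := by ring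
      _ ≤ _ := by
          refine mul_le_mul_of_nonneg_left ?_ hMN0
          simp only [div_eq_mul_inv] at t3 ⊢
          linarith
  -- the block bound
  unfold blockBound
  rw [← hCR, ← hΓ, ← hw]
  have hW0 : ∀ Λ, 0 ≤ windowBoundL6 (K + σ) Λ := fun Λ => by unfold windowBoundL6; positivity
  have hX0 : 0 ≤ Γ * windowBoundL6 (K + σ) (confLen σ (1 / M + w)) +
      ∑ i ∈ range (Nat.log 2 M + 1), min Γ ((N : ℝ) * M / 2 ^ (i + 1)) *
        windowBoundL6 (K + σ) (confLen σ ((2 : ℝ) ^ (i + 1) / M + w)) :=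
    add_nonneg (mul_nonneg hΓ0 (hW0 _))
      (Finset.sum_nonneg fun i _ => mul_nonneg (le_min hΓ0 (by positivity)) (hW0 _))
  calc 2 * windowBoundL6 (K + σ) (2 ^ e) * (CR * (Γ * windowBoundL6 (K + σ) (confLen σ (1 / M + w)) +
        ∑ i ∈ range (Nat.log 2 M + 1), min Γ ((N : ℝ) * M / 2 ^ (i + 1)) *
          windowBoundL6 (K + σ) (confLen σ ((2 : ℝ) ^ (i + 1) / M + w))))
      ≤ 2 * (4 * De ^ κ) * (CR * (4 * ((I + 2) * Γ * (4 * β + 1) ^ κ + Γ * (2 * Q / M) ^ κ +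
          (I + 1) * (4 * Q / M) ^ κ * Real.sqrt (Γ * (N * M))))) := by
        refine mul_le_mul (mul_le_mul_of_nonneg_left hJ6e (by norm_num))
          (mul_le_mul_of_nonneg_left hinner hCR0) (mul_nonneg hCR0 hX0) (by positivity)
    _ = 32 * CR * (De ^ κ * ((I + 2) * Γ * (4 * β + 1) ^ κ + Γ * (2 * Q / M) ^ κ +
          (I + 1) * (4 * Q / M) ^ κ * Real.sqrt (Γ * (N * M)))) := by ring
    _ ≤ 32 * CR * (M * N * (83 * (I + 2) ^ 2 * L' ^ 2 * y ^ (κ - 1 / 2) + 25 * (I + 2) * (L' * M) ^ (2 * κ) / N +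
          19 * (I + 2) * L' * (L' * M) ^ κ / Real.sqrt N)) := mul_le_mul_of_nonneg_left hY (by positivity)
    _ = _ := by ring


end EvalL6



section Final

set_option maxHeartbeats 1000000 in
/-- **The pair sum of `W_{S'}` for a shifted window, evaluated** (Bourgain 2013, (2.23)–(2.28) for
`K ≥ μ − ρ`, explicit form). In the setting of `pairSum_localised_le` assume moreover
`N₀ ≤ N`, `2^K ≤ N` (i.e. `L2^K ≤ N` up to the factor `L`), `2^σ ≤ L'M` (`σ = μ + ρ'`,
`L' = 2·2^{ρ'}`), and let `y ≥ 1` be the threshold between the Lemma-6 branch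
(`2^e(N₀+N)/2^K ≥ y`, (2.25)–(2.26)) and the sup branch (`< y`, (2.27)). Then, with
`η = 2·2^{-c₂ s}` (`s = |S'|`), `A₁ = 4(K+2)2^{κσ}`, `C_R = 4K₁L + 2`, `I = log₂ M`,
`E = σ + log₂ K₁ + 3`, `κ = walshL1Exponent`:
`pairSum ≤ MN · { η²(4K₁+2)(2L + L'(1 + log 2^σ))`  (diagonal (2.13)–(2.14))
`+ A₁² (130(I+2)/M + 8K₁/2^K + 4/N)`  (long arcs (2.24): saving `A₁²/M ≈ M^{2κ-1}`)
`+ E · ( 2η²C_R [(I+2)(5(I+2)L' + 5y/N)(2L'+4y+1) + 2(I+1)L'y]`  ((2.27): `L^C ‖ŵ‖_∞²`)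
`      + 32 C_R [83(I+2)²L'² y^{κ-1/2} + 25(I+2)(L'M)^{2κ}/N + 19(I+2)L'(L'M)^κ/√N] ) }`  ((2.25)–(2.26)).
[cite: Bourgain2013MoebiusWalsh, (2.23)–(2.28)] -/
theorem pairSum_localised_le_explicit {K σ K₁ : ℕ} (A : Finset (Fin (K + σ)))
    (hA : ∀ j ∈ A, K ≤ (j : ℕ)) (hK₁ : 1 ≤ K₁) (hKq : 4 * K₁ ≤ 2 ^ K) {M : ℕ} (hM : 0 < M)
    {d : ℕ} (hd : 1 ≤ d) {L : ℕ} (hdL : d ≤ L) {N₀ N : ℕ} (hN₀ : N₀ ≤ N)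
    (hKN : 2 ^ K ≤ N) {y L' : ℝ} (hy : 1 ≤ y) (hL' : 1 ≤ L') (hσL : (2 : ℝ) ^ σ ≤ L' * M) :
    pairSum (fun k => ‖localisedCoeff K σ K₁ A k‖) (2 * (K₁ * 2 ^ σ)) M K σ d N₀ N ≤
      M * N * ((2 * (2 : ℝ) ^ (-(walshSupExponent * A.card))) ^ 2 * (4 * K₁ + 2) *
          (2 * L + L' * (1 + Real.log (2 ^ σ))) +
        (4 * ((K : ℝ) + 2) * (2 : ℝ) ^ (walshL1Exponent * σ)) ^ 2 *
          (130 * ((Nat.log 2 M : ℝ) + 2) / M + 8 * K₁ / 2 ^ K + 4 / N) +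
        ((σ + Nat.log 2 K₁ + 3 : ℕ) : ℝ) *
          (2 * (2 * (2 : ℝ) ^ (-(walshSupExponent * A.card))) ^ 2 * (4 * K₁ * L + 2) *
              (((Nat.log 2 M : ℝ) + 2) * (5 * ((Nat.log 2 M : ℝ) + 2) * L' + 5 * y / N) * (2 * L' + 4 * y + 1) +
                2 * ((Nat.log 2 M : ℝ) + 1) * L' * y) +
            32 * (4 * K₁ * L + 2) *
              (83 * ((Nat.log 2 M : ℝ) + 2) ^ 2 * L' ^ 2 * y ^ (walshL1Exponent - 1 / 2) +
                25 * ((Nat.log 2 M : ℝ) + 2) * (L' * M) ^ (2 * walshL1Exponent) / N +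
                19 * ((Nat.log 2 M : ℝ) + 2) * L' * (L' * M) ^ walshL1Exponent / Real.sqrt N))) := by
  set R : ℕ := 2 * (K₁ * 2 ^ σ) with hR
  set a : ℤ → ℝ := fun k => ‖localisedCoeff K σ K₁ A k‖ with ha
  set η : ℝ := 2 * (2 : ℝ) ^ (-(walshSupExponent * A.card)) with hη
  set A₁ : ℝ := 4 * ((K : ℝ) + 2) * (2 : ℝ) ^ (walshL1Exponent * σ) with hA₁
  set E : ℕ := σ + Nat.log 2 K₁ + 3 with hE
  set I : ℝ := (Nat.log 2 M : ℝ) with hI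
  set κ : ℝ := walshL1Exponent with hκ
  set T3 : ℝ := 2 * η ^ 2 * (4 * K₁ * L + 2) *
    ((I + 2) * (5 * (I + 2) * L' + 5 * y / N) * (2 * L' + 4 * y + 1) + 2 * (I + 1) * L' * y) with hT3
  set T4 : ℝ := 32 * (4 * K₁ * L + 2) *
    (83 * (I + 2) ^ 2 * L' ^ 2 * y ^ (κ - 1 / 2) + 25 * (I + 2) * (L' * M) ^ (2 * κ) / N +
      19 * (I + 2) * L' * (L' * M) ^ κ / Real.sqrt N) with hT4
  have hMr : (0 : ℝ) < M := by exact_mod_cast hM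
  have hN1 : 1 ≤ N := le_trans Nat.one_le_two_pow hKN
  have hNr : (0 : ℝ) < N := by exact_mod_cast hN1
  have hy0 : 0 < y := by linarith
  have hI0 : 0 ≤ I := by rw [hI]; positivity
  have hT3nn : 0 ≤ T3 := by rw [hT3]; positivity
  have hT4nn : 0 ≤ T4 := by
    rw [hT4]
    have : 0 ≤ y ^ (κ - 1 / 2) := Real.rpow_nonneg hy0.le _
    positivity
  have ha0 : ∀ k, 0 ≤ a k := fun k => norm_nonneg _
  have haη : ∀ k, a k ≤ η := fun k => norm_localisedCoeff_le_sup K σ K₁ A k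
  have hd0 : d ≠ 0 := by omega
  have hℓ : (d : ℤ) ≠ 0 := by exact_mod_cast hd0
  have hℓL : (d : ℤ).natAbs ≤ L := by rw [Int.natAbs_natCast]; exact hdL
  have h2E : 2 * R ≤ 2 ^ E := by
    have h1 : K₁ < 2 ^ (Nat.log 2 K₁ + 1) := Nat.lt_pow_succ_log_self one_lt_two K₁
    calc 2 * R = 2 ^ σ * (4 * K₁) := by rw [hR]; ring
      _ ≤ 2 ^ σ * (4 * 2 ^ (Nat.log 2 K₁ + 1)) := Nat.mul_le_mul_left _ (Nat.mul_le_mul_left _ h1.le)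
      _ = 2 ^ E := by
          rw [hE, show σ + Nat.log 2 K₁ + 3 = σ + ((Nat.log 2 K₁ + 1) + 2) by ring, pow_add, pow_add]; ring
  have hA₁sum : ∑ k ∈ Ioo (-(R : ℤ)) R, a k ≤ A₁ := sum_Ioo_norm_localisedCoeff_le A hA hKq
  have hCR : 2 * (R : ℝ) * L / (2 : ℝ) ^ σ + 2 = 4 * K₁ * L + 2 := by
    rw [hR]; push_cast; field_simp; ring
  -- diagonal
  have hdiag : ∑ n ∈ Ico N₀ (N₀ + N), ∑ k ∈ Ioo (-(R : ℤ)) R, a k * a k * geomBound M (pairPhase K σ d k k n) ≤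
      M * N * (η ^ 2 * (4 * K₁ + 2) * (2 * L + L' * (1 + Real.log (2 ^ σ)))) := by
    refine (pairSum_diag_le ha0 haη R M K σ hℓ N₀ N).trans ?_
    have hRσ : 2 * (R : ℝ) / 2 ^ σ + 2 = 4 * K₁ + 2 := by rw [hR]; push_cast; field_simp; ring
    rw [hRσ, Int.natAbs_natCast]
    have hv : (2 : ℝ) ^ (d.factorization 2 + 1) ≤ 2 * L := by
      have h1 := Nat.ordProj_le 2 hd0
      have h2 : ((2 ^ d.factorization 2 : ℕ) : ℝ) ≤ d := by exact_mod_cast h1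
      have h3 : (d : ℝ) ≤ L := by exact_mod_cast hdL
      rw [pow_succ]; push_cast at h2; nlinarith
    have hlog : 0 ≤ Real.log ((2 : ℝ) ^ σ) := Real.log_nonneg (one_le_pow₀ (by norm_num))
    have hQ : (2 : ℝ) ^ σ * (1 + Real.log (2 ^ σ)) ≤ M * (L' * (1 + Real.log (2 ^ σ))) := by
      rw [← mul_assoc]; exact mul_le_mul_of_nonneg_right (by linarith) (by linarith)
    have hη2 : 0 ≤ η ^ 2 * (4 * (K₁ : ℝ) + 2) := by positivity
    calc (N : ℝ) * η ^ 2 * ((4 * K₁ + 2) * (2 ^ (d.factorization 2 + 1) * M + 2 ^ σ * (1 + Real.log (2 ^ σ))))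
        = N * (η ^ 2 * (4 * K₁ + 2)) * (2 ^ (d.factorization 2 + 1) * M + 2 ^ σ * (1 + Real.log (2 ^ σ))) := by ring
      _ ≤ N * (η ^ 2 * (4 * K₁ + 2)) * ((2 * L) * M + M * (L' * (1 + Real.log (2 ^ σ)))) := by
          refine mul_le_mul_of_nonneg_left (add_le_add ?_ hQ) (by positivity)
          exact mul_le_mul_of_nonneg_right hv hMr.le
      _ = M * N * (η ^ 2 * (4 * K₁ + 2) * (2 * L + L' * (1 + Real.log (2 ^ σ)))) := by ring
  -- long arcs
  have hlong : ∑ n ∈ Ico N₀ (N₀ + N), ∑ k ∈ Ioo (-(R : ℤ)) R, ∑ k' ∈ Ioo (-(R : ℤ)) R,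
      (if (2 : ℤ) ^ (K + σ) < 16 * ((N₀ + N : ℕ) : ℤ) * |k - k'| then
        a k * a k' * geomBound M (pairPhase K σ d k k' n) else 0) ≤
      M * N * (A₁ ^ 2 * (130 * (I + 2) / M + 8 * K₁ / 2 ^ K + 4 / N)) := by
    refine (pairSum_long_le ha0 hA₁sum hM K σ (d : ℤ) N₀ N).trans ?_
    rw [← hI]
    have hRN : 2 * (R : ℝ) * N / 2 ^ (K + σ) = 4 * K₁ * N / 2 ^ K := by
      rw [hR, pow_add]; push_cast; field_simp; ring
    rw [hRN]
    have hNt : ((N₀ + N : ℕ) : ℝ) ≤ 2 * N := by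
      have h0 : (N₀ : ℝ) ≤ N := by exact_mod_cast hN₀
      push_cast; linarith
    have hA0 : 0 ≤ A₁ ^ 2 := sq_nonneg _
    calc A₁ ^ 2 * ((I + 2) * (2 * N + 64 * ((N₀ + N : ℕ) : ℝ)) + 2 * M * (4 * K₁ * N / 2 ^ K + 2))
        ≤ A₁ ^ 2 * ((I + 2) * (2 * N + 64 * (2 * N)) + 2 * M * (4 * K₁ * N / 2 ^ K + 2)) := by gcongr
      _ = M * N * (A₁ ^ 2 * (130 * (I + 2) / M + 8 * K₁ / 2 ^ K + 4 / N)) := by field_simp; ring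
  -- blocks
  have hblock : ∀ e : ℕ, ∑ n ∈ Ico N₀ (N₀ + N), ∑ k ∈ Ioo (-(R : ℤ)) R, ∑ k' ∈ Ioo (-(R : ℤ)) R,
      (if InShortBlock K σ (N₀ + N) e k k' then a k * a k' * geomBound M (pairPhase K σ d k k' n) else 0) ≤
      M * N * (T3 + T4) := by
    intro e
    by_cases hne : 16 * (N₀ + N) * 2 ^ e ≤ 2 ^ (K + σ)
    · by_cases hβ : (2 : ℝ) ^ e * ((N₀ + N : ℕ) : ℝ) / 2 ^ K < y
      · refine (pairSum_block_le_blockBound ha0 hM K σ hℓ hℓL N₀ N e (windowBoundSup A.card) ?_).trans ?_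
        · intro x Λ _
          calc ∑ k ∈ Ico x (x + Λ), a k ≤ ∑ _k ∈ Ico x (x + Λ), η := Finset.sum_le_sum fun k _ => haη k
            _ = windowBoundSup A.card Λ := by
                rw [Finset.sum_const, Int.card_Ico, nsmul_eq_mul, show x + Λ - x = (Λ : ℤ) by ring,
                  Int.toNat_natCast, windowBoundSup, hη]; ring
        · refine (blockBound_sup_le R M K σ L N₀ N e A.card hM hy hL' hσL hN₀ hKN hne hβ).trans ?_
          rw [hCR, ← hη, ← hI, ← hT3]
          exact mul_le_mul_of_nonneg_left (le_add_of_nonneg_right hT4nn) (by positivity)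
      · refine (pairSum_block_le_blockBound ha0 hM K σ hℓ hℓL N₀ N e (windowBoundL6 (K + σ)) ?_).trans ?_
        · -- the Lemma-6 majorant (as in `pairSum_localised_le`)
          intro x Λ hΛ1
          rcases le_or_gt Λ (2 ^ (K + σ)) with hΛ | hΛ
          · rw [windowBoundL6, min_eq_left hΛ]
            exact sum_Ico_norm_localisedCoeff_le K σ K₁ A x hΛ1 hΛ
          · rw [windowBoundL6, min_eq_right hΛ.le]
            have hRP : 2 * R ≤ 2 ^ (K + σ) := by
              rw [hR, pow_add]
              calc 2 * (2 * (K₁ * 2 ^ σ)) = (4 * K₁) * 2 ^ σ := by ring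
                _ ≤ 2 ^ K * 2 ^ σ := Nat.mul_le_mul_right _ hKq
            have hvan : ∀ k : ℤ, R ≤ k.natAbs → a k = 0 := fun k hk => by
              simp only [ha]; rw [localisedCoeff_eq_zero A (by rw [hR] at hk; exact hk), norm_zero]
            calc ∑ k ∈ Ico x (x + Λ), a k = ∑ k ∈ (Ico x (x + Λ)).filter (fun k : ℤ => k.natAbs < R), a k := by
                  rw [Finset.sum_filter]
                  refine Finset.sum_congr rfl fun k _ => ?_
                  split_ifs with h
                  · rfl
                  · exact hvan k (not_lt.mp h)
              _ ≤ ∑ k ∈ Ico (-(R : ℤ)) (-(R : ℤ) + (2 ^ (K + σ) : ℕ)), a k := by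
                  refine Finset.sum_le_sum_of_subset_of_nonneg ?_ fun k _ _ => ha0 k
                  intro k hk
                  rw [Finset.mem_filter] at hk
                  rw [Finset.mem_Ico]
                  have h2 : (2 * R : ℤ) ≤ ((2 ^ (K + σ) : ℕ) : ℤ) := by exact_mod_cast hRP
                  omega
              _ ≤ 4 * (((2 ^ (K + σ) : ℕ)) : ℝ) ^ walshL1Exponent :=
                  sum_Ico_norm_localisedCoeff_le K σ K₁ A _ Nat.one_le_two_pow le_rfl
        · refine (blockBound_L6_le R M K σ L N₀ N e hM hy hL' hσL hN₀ hKN hne (not_lt.mp hβ)).trans ?_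
          rw [hCR, ← hI, ← hκ, ← hT4]
          exact mul_le_mul_of_nonneg_left (le_add_of_nonneg_left hT3nn) (by positivity)
    · -- empty block
      have hzero : ∀ n, ∀ k k' : ℤ, (if InShortBlock K σ (N₀ + N) e k k' then
          a k * a k' * geomBound M (pairPhase K σ d k k' n) else 0) = 0 := by
        intro n k k'
        rw [if_neg]
        rintro ⟨_, h16, hlo, _⟩
        apply hne
        have h1 : 16 * ((N₀ + N : ℕ) : ℤ) * (2 : ℤ) ^ e ≤ (2 : ℤ) ^ (K + σ) :=
          le_trans (mul_le_mul_of_nonneg_left hlo (by positivity)) h16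
        exact_mod_cast h1
      rw [Finset.sum_eq_zero fun n _ => Finset.sum_eq_zero fun k _ => Finset.sum_eq_zero fun k' _ => hzero n k k']
      positivity
  -- assemble
  have hparts := pairSum_le_parts ha0 M K σ (d : ℤ) N₀ N h2E
  refine hparts.trans ?_
  calc _ ≤ M * N * (η ^ 2 * (4 * K₁ + 2) * (2 * L + L' * (1 + Real.log (2 ^ σ)))) +
        M * N * (A₁ ^ 2 * (130 * (I + 2) / M + 8 * K₁ / 2 ^ K + 4 / N)) +
        ∑ _e ∈ range E, M * N * (T3 + T4) :=
        add_le_add (add_le_add hdiag hlong) (Finset.sum_le_sum fun e _ => hblock e)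
    _ = _ := by
        rw [Finset.sum_const, Finset.card_range, nsmul_eq_mul, hT3, hT4, hη, hA₁, hI, hκ]
        ring

end Final



end Literature.NumberTheory.LFunctions.MoebiusWalsh

end
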